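import Literature.NumberTheory.Sieve.IwaniecAlmostPrimesQuadraticProp2Prep
import Literature.NumberTheory.Sieve.IwaniecAlmostPrimesRhoMeanValue
import Literature.NumberTheory.Sieve.PolynomialCongruencesMeanValues
import HarnessLib

/-!
# Iwaniec (1978) for a general quadratic `G`: the mean value of `ρ_G` with coprimality and congruence conditions — PROVED

H. Iwaniec, *Almost-primes represented by quadratic polynomials*, Invent. Math. **47** (1978)
171–188, §4 p. 179 ("By (15) of Lemma 6 it follows that `Σ⁰ = Σ⁰(M₁) − Σ⁰(M) + O(M^{3/4})`"),
for the sequence `𝒜_G`, `G = aX² + bX + c` irreducible, `a > 0`, `c` odd; R. J. Lemke Oliver,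
Acta Arith. **151** (2012), Lemma 6 / Lemma 9 p. 251 (the mean value of `ρ` over
`m ≡ μ (mod d)`, `(m, Q) = 1`).  General-`G` version of `IwaniecAlmostPrimesRhoMeanValue.lean`
(fourteenth file of the inline proof of `theorem_quadratic`); everything here is PROVED, no
named fact is introduced.

For `G = X² + 1` one has `ρ = μ² ⋆ χ₄`; for a general `G` the local factors of `ρ_G` are those of
`1 ⋆ μ²ψ_Δ` (`ψ_Δ = (Δ/·)`, the Kronecker symbol of the discriminant `Δ = b² − 4ac`) only at the
primes `p ∤ D₀ = 2aΔ`, and the integers `m` of the dispersion method are prime to `Q = n₁n₂` but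
not to `D₀`.  Accordingly:

* `rhoG_primePow_eq_of_not_dvd_disc` (Hensel at `p ∤ Δ`, from the resultant identity
  `4aG − (2aX + b)G' = −Δ` and the tree's `polyRootCountMod_prime_pow_eq`), `jacPsi` (`ψ_Δ`, with
  complete multiplicativity, periodicity mod `4|Δ|`, `ρ_G(p) = 1 + ψ_Δ(p)` for odd `p ∤ a`),
  `rhoGArith_pmul_copInd_eq` / `rhoG_eq_sum_divisors_sqfPsi` — **`ρ_G = 1 ⋆ μ²ψ_Δ` on the
  integers prime to `D₀`** (an identity of multiplicative functions);
* `sum_smooth_le` — sums of a multiplicative `g ≥ 0` over the `B`-smooth numbers are bounded by the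
  finite Euler product; `rhoGArith_eq_smooth_mul_good`, `sum_rhoG_mul_eq_sum_smooth_sum_good` —
  `ρ_G = (ρ_G 1_{D₀-smooth}) ⋆ (ρ_G 1_{(·,D₀)=1})`, splitting every sum of `ρ_G` into a smooth
  (bad) variable `s` and a good variable `t`;
* `sum_range_jacPsi_ap_eq_zero`, `abs_sum_Ioc_jacPsi_modEq_le` (`|∑_{A<n≤B, n≡ν (d)} ψ_Δ(n)| ≤ 2N`,
  `N = 4|Δ|`, `(d, N) = 1`: the Kronecker character is non-principal, `ne_one_of_forall_odd`),
  `abs_sum_jacPsi_coprime_modEq_le`, `abs_sum_jacPsi_sqf_coprime_modEq_le` (with coprimality and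
  squarefreeness by Möbius inversion), `abs_copCount_sub_le` (residue-class counting);
* `abs_goodSum_sub_le` — **the hyperbola method for the good variable**:
  `∑_{t ≤ W, (t,Q₁)=1, t ≡ ν (d)} ρ_G(t) = (φ(Q₁)/Q₁)(W/d) Λ(E) + O((τ(Q₁)+1)E + τ(Q₁) N W/√E)`,
  `Λ(E) = ∑_{e ≤ E, (e, Q₁d)=1} μ²ψ_Δ(e)/e` (`psiSeries`);
* `rhoSumAPG`, `kappaG`, **`abs_rhoSumAPG_sub_le`** — for `Q` squarefree, `d ∣ Q`, `(d, D₀) = 1`,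
  `(μ, d) = 1`, `E, T ≥ 1`, `TE ≤ Y`:
  `|∑_{m ≤ Y, (m,Q)=1, m ≡ μ (d)} ρ_G(m) − (κ_G(Q; E, T)/φ(d)) Y| ≤ C_G τ(Q) (log₂Y + 1)^{ω(D₀)+1} (E + Y/√E + Y/T)`,
  with `κ_G = (φ(D₀Q)/(D₀Q)) Λ(E; D₀Q) S(T; Q)` independent of the class `μ` and depending on `d`
  only through the displayed `1/φ(d)` — the one feature the dispersion identity uses
  (`IwaniecAlmostPrimesQuadraticDispersion.lean`).  The restriction `(d, 2aΔ) = 1` is exactly what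
  the `W`-count analysis produces (for the other `d` the pair count vanishes).

## References

* H. Iwaniec, Invent. Math. 47 (1978) 171–188, §4 p. 179 (`IwaniecInventiones1978`).
* R. J. Lemke Oliver, Acta Arith. 151 (2012) 241–261, Lemma 6, Lemma 9 (`LemkeOliverActaArith2012`).
* G. H. Hardy, E. M. Wright, *An Introduction to the Theory of Numbers*, Thm 123 (`HardyWright2008`).
-/

open Finset Real Polynomial
open scoped NumberTheorySymbols ArithmeticFunction

noncomputable section

namespace Literature.NumberTheory.Sieve.Iwaniec1978

variable {a b c : ℤ}

/-! ### Hensel: `ρ_G(p^k) = ρ_G(p)` for `p ∤ Δ` -/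

/-- The resultant identity for `G = aX² + bX + c`: `G · 4a + G' · (−(2aX + b)) = 4ca − b²`. [folklore] -/
theorem quadPoly_resultant_identity (a b c : ℤ) :
    quadPoly a b c * C (4 * a) + derivative (quadPoly a b c) * (-(C (2 * a) * X + C b)) =
      C (4 * c * a - b ^ 2) := by
  have hd : derivative (quadPoly a b c) = C (a * 2) * X + C b := by
    simp only [quadPoly, derivative_add, derivative_mul, derivative_C, derivative_X_pow,
      derivative_X, zero_mul, zero_add, add_zero, mul_one, Nat.cast_ofNat]
    simp only [map_mul]
    ring
  rw [hd]
  apply Polynomial.funext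
  intro x
  simp only [quadPoly, eval_add, eval_mul, eval_neg, eval_C, eval_X, eval_pow]
  ring

/-- **`ρ_G(p^k) = ρ_G(p)` for every prime `p ∤ Δ = b² − 4ac` and `k ≥ 1`** (the roots of `G`
modulo such `p` are simple: `4aG − (2aX+b)G' = −Δ`; Hensel, Hardy–Wright Thm 123).
[cite: HardyWright2008, Thm 123 (§8.3)] -/
theorem rhoG_primePow_eq_of_not_dvd_disc {p : ℕ} (hp : p.Prime)
    (hpΔ : ¬ (p : ℤ) ∣ b ^ 2 - 4 * a * c) {k : ℕ} (hk : 1 ≤ k) :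
    rhoG a b c (p ^ k) = rhoG a b c p := by
  have hAB := quadPoly_resultant_identity a b c
  have hpR : ¬ (p : ℤ) ∣ 4 * c * a - b ^ 2 := by
    intro h; apply hpΔ
    have e : b ^ 2 - 4 * a * c = -(4 * c * a - b ^ 2) := by ring
    rw [e]; exact h.neg_right
  unfold rhoG
  exact polyRootCountMod_prime_pow_eq hp
    (fun μ hμ => not_dvd_derivative_eval_of_not_dvd hAB hpR hμ) hk

/-! ### The symbol `ψ_Δ(n) = (Δ/n)` on odd `n` -/

/-- `ψ_Δ(n) = (Δ/n)` (Jacobi symbol) for odd `n`, `0` for even `n`: the completely multiplicative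
function with `ρ_G(p) = 1 + ψ_Δ(p)` at the odd primes `p ∤ a` (it is the Kronecker character
modulo `4|Δ|` restricted to `ℕ`). [folklore] -/
def jacPsi (Δ : ℤ) (n : ℕ) : ℝ := if Odd n then (J(Δ | n) : ℝ) else 0

/-- `ψ_Δ(n) = (Δ/n)` for odd `n`. [folklore] -/
theorem jacPsi_of_odd {Δ : ℤ} {n : ℕ} (hn : Odd n) : jacPsi Δ n = (J(Δ | n) : ℝ) := if_pos hn

/-- `ψ_Δ(n) = 0` for even `n`. [folklore] -/
theorem jacPsi_of_even {Δ : ℤ} {n : ℕ} (hn : Even n) : jacPsi Δ n = 0 :=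
  if_neg (Nat.not_odd_iff_even.2 hn)

/-- `ψ_Δ(0) = 0`. [folklore] -/
theorem jacPsi_zero (Δ : ℤ) : jacPsi Δ 0 = 0 := jacPsi_of_even (by decide)

/-- `ψ_Δ(1) = 1`. [folklore] -/
theorem jacPsi_one (Δ : ℤ) : jacPsi Δ 1 = 1 := by
  rw [jacPsi_of_odd odd_one, jacobiSym.one_right]; simp

/-- `|ψ_Δ(n)| ≤ 1`. [folklore] -/
theorem abs_jacPsi_le_one (Δ : ℤ) (n : ℕ) : |jacPsi Δ n| ≤ 1 := by
  unfold jacPsi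
  split_ifs with h
  · have h3 := jacobiSym.trichotomy Δ n
    rcases h3 with h0 | h1 | h2
    · rw [h0]; simp
    · rw [h1]; simp
    · rw [h2]; simp
  · simp

/-- `ψ_Δ` is completely multiplicative. [folklore] -/
theorem jacPsi_mul (Δ : ℤ) (m n : ℕ) : jacPsi Δ (m * n) = jacPsi Δ m * jacPsi Δ n := by
  by_cases hm : Odd m
  · by_cases hn : Odd n
    · haveI : NeZero m := ⟨hm.pos.ne'⟩
      haveI : NeZero n := ⟨hn.pos.ne'⟩
      rw [jacPsi_of_odd hm, jacPsi_of_odd hn, jacPsi_of_odd (hm.mul hn), jacobiSym.mul_right]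
      push_cast; ring
    · rw [jacPsi_of_even (n := n) (Nat.not_odd_iff_even.1 hn),
        jacPsi_of_even ((Nat.not_odd_iff_even.1 hn).mul_left m), mul_zero]
  · rw [jacPsi_of_even (n := m) (Nat.not_odd_iff_even.1 hm),
      jacPsi_of_even ((Nat.not_odd_iff_even.1 hm).mul_right n), zero_mul]

/-- `ψ_Δ(g)² = 1` for `g` odd and prime to `Δ`. [folklore] -/
theorem jacPsi_sq_eq_one {Δ : ℤ} {g : ℕ} (hg : Odd g) (hcop : Int.gcd Δ g = 1) :
    jacPsi Δ g ^ 2 = 1 := by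
  rw [jacPsi_of_odd hg]
  rcases jacobiSym.eq_one_or_neg_one (a := Δ) (b := g) hcop with h | h
  · rw [h]; norm_num
  · rw [h]; norm_num

/-- `ψ_Δ` is periodic modulo `4|Δ|`. [folklore] -/
theorem jacPsi_add_mul (Δ : ℤ) (n k : ℕ) : jacPsi Δ (n + 4 * Δ.natAbs * k) = jacPsi Δ n := by
  have hpar : Odd (n + 4 * Δ.natAbs * k) ↔ Odd n := by
    rw [Nat.odd_add]
    constructor
    · intro h; exact h.2 ⟨2 * Δ.natAbs * k, by ring⟩
    · intro h; exact ⟨fun _ => ⟨2 * Δ.natAbs * k, by ring⟩, fun _ => h⟩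
  by_cases hn : Odd n
  · rw [jacPsi_of_odd hn, jacPsi_of_odd (hpar.2 hn), jacobiSym.mod_right Δ (hpar.2 hn),
      jacobiSym.mod_right Δ hn]
    congr 2
    rw [Nat.add_mul_mod_self_left]
  · rw [jacPsi_of_even (Nat.not_odd_iff_even.1 hn),
      jacPsi_of_even (Nat.not_odd_iff_even.1 (fun h => hn (hpar.1 h)))]

/-- **`ρ_G(p) = 1 + ψ_Δ(p)` for odd primes `p ∤ a`.** [folklore] -/
theorem rhoG_prime_eq_one_add_jacPsi (ha : 0 < a) (hirr : Irreducible (quadPoly a b c)) {p : ℕ}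
    (hp : p.Prime) (hp2 : p ≠ 2) (hpa : ¬ (p : ℤ) ∣ a) :
    (rhoG a b c p : ℝ) = 1 + jacPsi (b ^ 2 - 4 * a * c) p := by
  rw [jacPsi_of_odd (hp.odd_of_ne_two hp2)]
  have h := rhoG_eq_one_add_jacobiSym ha hirr hp hp2 hpa
  have h' : ((rhoG a b c p : ℤ) : ℝ) = ((1 + J(b ^ 2 - 4 * a * c | p) : ℤ) : ℝ) := by rw [h]
  push_cast at h'
  exact h'

/-! ### The bad modulus `D₀ = |2aΔ|` and the good-part identity `ρ_G = 1 ⋆ μ²ψ_Δ` -/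

/-- `D₀ = |2aΔ|`: the integers prime to `D₀` are those built from "good" primes
(`p` odd, `p ∤ a`, `p ∤ Δ`). [folklore] -/
def badMod (a b c : ℤ) : ℕ := (2 * a * (b ^ 2 - 4 * a * c)).natAbs

/-- `D₀ ≠ 0`. [folklore] -/
theorem badMod_ne_zero (ha : 0 < a) (hirr : Irreducible (quadPoly a b c)) : badMod a b c ≠ 0 := by
  unfold badMod
  rw [Ne, Int.natAbs_eq_zero, mul_eq_zero, mul_eq_zero, not_or, not_or]
  exact ⟨⟨by norm_num, ha.ne'⟩, disc_ne_zero ha.ne' hirr⟩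

/-- A prime not dividing `D₀` is odd, prime to `a` and to `Δ`. [folklore] -/
theorem good_prime {p : ℕ} (hp : p.Prime) (hpD : ¬ p ∣ badMod a b c) :
    p ≠ 2 ∧ ¬ (p : ℤ) ∣ a ∧ ¬ (p : ℤ) ∣ b ^ 2 - 4 * a * c := by
  unfold badMod at hpD
  rw [← Int.natCast_dvd] at hpD
  refine ⟨?_, ?_, ?_⟩
  · rintro rfl; apply hpD; push_cast; exact dvd_mul_of_dvd_left (dvd_mul_right 2 a) _
  · intro h; apply hpD; exact dvd_mul_of_dvd_left (dvd_mul_of_dvd_right h 2) _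
  · intro h; apply hpD; exact dvd_mul_of_dvd_right h _

/-- The indicator of `(n, D) = 1` (`n ≥ 1`) as an arithmetic function. [folklore] -/
def copInd (D : ℕ) : ArithmeticFunction ℝ :=
  ⟨fun n => if 0 < n ∧ n.Coprime D then 1 else 0, by simp⟩

/-- Unfolding `copInd`. [folklore] -/
theorem copInd_apply (D n : ℕ) : copInd D n = if 0 < n ∧ n.Coprime D then 1 else 0 := rfl

/-- `1_{(·,D)=1}` is multiplicative. [folklore] -/
theorem isMultiplicative_copInd (D : ℕ) : (copInd D).IsMultiplicative := by
  refine ⟨by simp [copInd_apply], fun {m n} _ => ?_⟩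
  simp only [copInd_apply, Nat.coprime_mul_iff_left, CanonicallyOrderedAdd.mul_pos]
  by_cases h1 : 0 < m ∧ m.Coprime D
  · by_cases h2 : 0 < n ∧ n.Coprime D
    · rw [if_pos ⟨⟨h1.1, h2.1⟩, h1.2, h2.2⟩, if_pos h1, if_pos h2, mul_one]
    · rw [if_neg h2, mul_zero, if_neg]
      rintro ⟨⟨-, hn⟩, -, hn'⟩; exact h2 ⟨hn, hn'⟩
  · rw [if_neg h1, zero_mul, if_neg]
    rintro ⟨⟨hm, -⟩, hm', -⟩; exact h1 ⟨hm, hm'⟩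

/-- `ψ_Δ` as an arithmetic function. [folklore] -/
def jacPsiA (Δ : ℤ) : ArithmeticFunction ℝ := ⟨jacPsi Δ, jacPsi_zero Δ⟩

/-- Unfolding `jacPsiA`. [folklore] -/
theorem jacPsiA_apply (Δ : ℤ) (n : ℕ) : jacPsiA Δ n = jacPsi Δ n := rfl

/-- `ψ_Δ` is multiplicative. [folklore] -/
theorem isMultiplicative_jacPsiA (Δ : ℤ) : (jacPsiA Δ).IsMultiplicative :=
  ⟨jacPsi_one Δ, fun {m n} _ => jacPsi_mul Δ m n⟩

/-- `μ²ψ_Δ(n) = [n squarefree] ψ_Δ(n)`. [folklore] -/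
def sqfPsi (Δ : ℤ) : ArithmeticFunction ℝ := moebiusSq.pmul (jacPsiA Δ)

/-- Unfolding `sqfPsi`. [folklore] -/
theorem sqfPsi_apply (Δ : ℤ) (n : ℕ) : sqfPsi Δ n = if Squarefree n then jacPsi Δ n else 0 := by
  unfold sqfPsi
  rw [ArithmeticFunction.pmul_apply, moebiusSq_apply, jacPsiA_apply]
  split_ifs <;> simp

/-- `μ²ψ_Δ` is multiplicative. [folklore] -/
theorem isMultiplicative_sqfPsi (Δ : ℤ) : (sqfPsi Δ).IsMultiplicative :=
  isMultiplicative_moebiusSq.pmul (isMultiplicative_jacPsiA Δ)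

/-- `|μ²ψ_Δ(n)| ≤ 1`. [folklore] -/
theorem abs_sqfPsi_le_one (Δ : ℤ) (n : ℕ) : |sqfPsi Δ n| ≤ 1 := by
  rw [sqfPsi_apply]; split_ifs
  · exact abs_jacPsi_le_one Δ n
  · simp

/-- A Dirichlet convolution at a prime power. [folklore] -/
theorem mul_apply_prime_pow (f g : ArithmeticFunction ℝ) {p : ℕ} (hp : p.Prime) (k : ℕ) :
    (f * g) (p ^ k) = ∑ i ∈ Finset.range (k + 1), f (p ^ i) * g (p ^ (k - i)) := by
  rw [ArithmeticFunction.mul_apply, Nat.sum_divisorsAntidiagonal (fun i j => f i * g j),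
    Nat.divisors_prime_pow hp, Finset.sum_map]
  refine Finset.sum_congr rfl fun i hi => ?_
  rw [Finset.mem_range] at hi
  simp only [Function.Embedding.coeFn_mk]
  rw [Nat.pow_div (by omega) hp.pos]

/-- **The good-part identity `ρ_G = 1 ⋆ μ²ψ_Δ` on the integers prime to `D₀ = |2aΔ|`**, as an
identity of multiplicative functions:
`ρ_G · 1_{(·,D₀)=1} = 1_{(·,D₀)=1} ⋆ (μ²ψ_Δ · 1_{(·,D₀)=1})` (at `p ∤ D₀`:
`ρ_G(p^k) = ρ_G(p) = 1 + ψ_Δ(p) = ∑_{j ≤ k} μ²ψ_Δ(p^j)`). [folklore] -/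
theorem rhoGArith_pmul_copInd_eq (ha : 0 < a) (hirr : Irreducible (quadPoly a b c)) :
    (rhoGArith a b c).pmul (copInd (badMod a b c)) =
      copInd (badMod a b c) * (sqfPsi (b ^ 2 - 4 * a * c)).pmul (copInd (badMod a b c)) := by
  set D := badMod a b c with hD
  set Δ := b ^ 2 - 4 * a * c with hΔ
  have hD0 : D ≠ 0 := badMod_ne_zero ha hirr
  have hL : ((rhoGArith a b c).pmul (copInd D)).IsMultiplicative :=
    isMultiplicative_rhoGArith.pmul (isMultiplicative_copInd D)
  have hR : (copInd D * (sqfPsi Δ).pmul (copInd D)).IsMultiplicative :=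
    (isMultiplicative_copInd D).mul ((isMultiplicative_sqfPsi Δ).pmul (isMultiplicative_copInd D))
  rw [ArithmeticFunction.IsMultiplicative.eq_iff_eq_on_prime_powers _ hL _ hR]
  intro p k hp
  rw [mul_apply_prime_pow _ _ hp]
  simp only [ArithmeticFunction.pmul_apply, copInd_apply, rhoGArith_apply, sqfPsi_apply]
  rcases Nat.eq_zero_or_pos k with rfl | hk
  · -- `k = 0`
    have h1 : 0 < p ^ 0 ∧ (p ^ 0).Coprime D := ⟨Nat.one_pos, by rw [pow_zero]; exact Nat.coprime_one_left D⟩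
    simp only [pow_zero, rhoG_one]
    norm_num
    rw [jacPsi_one]
  by_cases hpD : p ∣ D
  · -- bad prime: both sides vanish
    have hnc : ∀ i, 0 < i → ¬ (0 < p ^ i ∧ (p ^ i).Coprime D) := by
      rintro i hi ⟨-, h⟩
      have := Nat.Coprime.coprime_dvd_left (dvd_pow_self p hi.ne') h
      exact (Nat.Prime.coprime_iff_not_dvd hp).1 this hpD
    rw [if_neg (hnc k hk)]
    rw [mul_zero]
    symm
    refine Finset.sum_eq_zero fun i hi => ?_
    rw [Finset.mem_range] at hi
    rcases Nat.eq_zero_or_pos i with rfl | hi0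
    · rw [Nat.sub_zero, if_neg (hnc k hk)]; simp
    · rw [if_neg (hnc i hi0)]; simp
  · -- good prime
    obtain ⟨hp2, hpa, hpΔ⟩ := good_prime hp hpD
    have hcop : ∀ i, 0 < p ^ i ∧ (p ^ i).Coprime D := fun i =>
      ⟨pow_pos hp.pos i, Nat.Coprime.pow_left i ((Nat.Prime.coprime_iff_not_dvd hp).2 hpD)⟩
    simp only [if_pos (hcop _), mul_one, one_mul]
    rw [rhoG_primePow_eq_of_not_dvd_disc hp hpΔ hk, rhoG_prime_eq_one_add_jacPsi ha hirr hp hp2 hpa]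
    -- reindex `j = k - i`; only `j = 0, 1` survive
    have hrefl : ∑ i ∈ Finset.range (k + 1),
        (if Squarefree (p ^ (k - i)) then jacPsi Δ (p ^ (k - i)) else 0) =
        ∑ j ∈ Finset.range (k + 1), (if Squarefree (p ^ j) then jacPsi Δ (p ^ j) else 0) := by
      have := Finset.sum_range_reflect
        (fun j => if Squarefree (p ^ j) then jacPsi Δ (p ^ j) else 0) (k + 1)
      simp only [Nat.add_sub_cancel] at this
      exact this
    rw [hrefl, show k + 1 = (k - 1) + 1 + 1 by omega, Finset.sum_range_succ', Finset.sum_range_succ']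
    have hz : ∀ j ∈ Finset.range (k - 1),
        (if Squarefree (p ^ (j + 1 + 1)) then jacPsi Δ (p ^ (j + 1 + 1)) else 0) = 0 := by
      intro j _
      rw [if_neg]
      rw [Nat.squarefree_pow_iff hp.one_lt.ne' (by omega)]
      omega
    rw [Finset.sum_eq_zero hz, pow_zero, pow_one, if_pos squarefree_one, if_pos hp.prime.squarefree,
      jacPsi_one]
    ring

/-- **`ρ_G(m) = ∑_{f ∣ m} μ²ψ_Δ(f)` for `m ≥ 1` prime to `D₀ = |2aΔ|`.** [folklore] -/
theorem rhoG_eq_sum_divisors_sqfPsi (ha : 0 < a) (hirr : Irreducible (quadPoly a b c)) {m : ℕ}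
    (hm : 0 < m) (hcop : m.Coprime (badMod a b c)) :
    (rhoG a b c m : ℝ) = ∑ f ∈ m.divisors, sqfPsi (b ^ 2 - 4 * a * c) f := by
  have h := congrArg (fun F : ArithmeticFunction ℝ => F m) (rhoGArith_pmul_copInd_eq ha hirr)
  simp only [ArithmeticFunction.pmul_apply, rhoGArith_apply, copInd_apply,
    ArithmeticFunction.mul_apply] at h
  rw [if_pos (show 0 < m ∧ m.Coprime (badMod a b c) from ⟨hm, hcop⟩), mul_one] at h
  rw [h, Nat.sum_divisorsAntidiagonal' (fun e f => (if 0 < e ∧ e.Coprime (badMod a b c) then (1 : ℝ) else 0) *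
    (sqfPsi (b ^ 2 - 4 * a * c) f * (if 0 < f ∧ f.Coprime (badMod a b c) then (1 : ℝ) else 0)))]
  refine Finset.sum_congr rfl fun f hf => ?_
  have hfm : f ∣ m := Nat.dvd_of_mem_divisors hf
  have hf0 : 0 < f := Nat.pos_of_mem_divisors hf
  have hmf0 : 0 < m / f := Nat.div_pos (Nat.le_of_dvd hm hfm) hf0
  rw [if_pos ⟨hmf0, hcop.coprime_dvd_left (Nat.div_dvd_of_dvd hfm)⟩,
    if_pos ⟨hf0, hcop.coprime_dvd_left hfm⟩]
  ring

/-! ### Sums over smooth numbers: a finite Euler-product bound -/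

/-- **Sums of a non-negative multiplicative `g` over the `B`-smooth numbers up to `T`** are at most
the finite Euler product `∏_{p ∈ B} ∑_{k ≤ log_p T} g(p^k)` (`g(1) ≤ 1`). [folklore] -/
theorem sum_smooth_le (g : ℕ → ℝ) (hg0 : ∀ n, 0 ≤ g n) (hg1 : g 1 ≤ 1)
    (hmul : ∀ m n : ℕ, m.Coprime n → g (m * n) = g m * g n) (T : ℕ) (B : Finset ℕ)
    (hB : ∀ p ∈ B, p.Prime) :
    ∑ m ∈ (Finset.Ioc 0 T).filter (fun m => m.primeFactors ⊆ B), g m ≤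
      ∏ p ∈ B, ∑ k ∈ Finset.range (Nat.log p T + 1), g (p ^ k) := by
  classical
  induction B using Finset.induction_on with
  | empty =>
    rw [Finset.prod_empty]
    have hsub : (Finset.Ioc 0 T).filter (fun m => m.primeFactors ⊆ ∅) ⊆ {1} := by
      intro m hm
      rw [Finset.mem_filter, Finset.mem_Ioc, Finset.subset_empty, Nat.primeFactors_eq_empty] at hm
      rw [Finset.mem_singleton]; omega
    calc ∑ m ∈ (Finset.Ioc 0 T).filter (fun m => m.primeFactors ⊆ ∅), g m ≤ ∑ m ∈ {1}, g m :=
          Finset.sum_le_sum_of_subset_of_nonneg hsub fun _ _ _ => hg0 _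
      _ = g 1 := Finset.sum_singleton _ _
      _ ≤ 1 := hg1
  | insert p B hpB ih =>
    have hp : p.Prime := hB p (Finset.mem_insert_self p B)
    have hB' : ∀ q ∈ B, q.Prime := fun q hq => hB q (Finset.mem_insert_of_mem hq)
    rw [Finset.prod_insert hpB]
    set S' := (Finset.Ioc 0 T).filter (fun m => m.primeFactors ⊆ insert p B) with hS'
    set S := (Finset.Ioc 0 T).filter (fun m => m.primeFactors ⊆ B) with hS
    set L := Finset.range (Nat.log p T + 1) with hL
    set φ : ℕ → ℕ × ℕ := fun m => (m.factorization p, ordCompl[p] m) with hφ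
    set G : ℕ × ℕ → ℝ := fun x => g (p ^ x.1) * g x.2 with hG
    have hG0 : ∀ x, 0 ≤ G x := fun x => mul_nonneg (hg0 _) (hg0 _)
    -- `g m = G (φ m)` and `φ` maps `S'` injectively into `L × S`
    have hgφ : ∀ m ∈ S', g m = G (φ m) := by
      intro m hm
      rw [hS', Finset.mem_filter, Finset.mem_Ioc] at hm
      have hm0 : m ≠ 0 := by omega
      simp only [hG, hφ]
      conv_lhs => rw [← Nat.ordProj_mul_ordCompl_eq_self m p]
      exact hmul _ _ ((Nat.coprime_ordCompl hp hm0).pow_left _)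
    have hmaps : ∀ m ∈ S', φ m ∈ L ×ˢ S := by
      intro m hm
      rw [hS', Finset.mem_filter, Finset.mem_Ioc] at hm
      have hm0 : m ≠ 0 := by omega
      have hT0 : T ≠ 0 := by omega
      simp only [hφ, hL, hS, Finset.mem_product, Finset.mem_range, Finset.mem_filter, Finset.mem_Ioc]
      refine ⟨?_, ⟨Nat.ordCompl_pos p hm0, (Nat.ordCompl_le m p).trans hm.1.2⟩, ?_⟩
      · rw [Nat.lt_succ_iff, Nat.le_log_iff_pow_le hp.one_lt hT0]
        exact (Nat.le_of_dvd (by omega) (Nat.ordProj_dvd m p)).trans hm.1.2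
      · intro q hq
        have hq' := Nat.mem_primeFactors.1 hq
        have hqm : q ∣ m := hq'.2.1.trans (Nat.ordCompl_dvd m p)
        have hqmem : q ∈ m.primeFactors := Nat.mem_primeFactors.2 ⟨hq'.1, hqm, hm0⟩
        have := hm.2 hqmem
        rw [Finset.mem_insert] at this
        rcases this with rfl | h
        · exact absurd hq'.2.1 (Nat.not_dvd_ordCompl hp hm0)
        · exact h
    have hinj : Set.InjOn φ S' := by
      intro m _ m' _ h
      simp only [hφ, Prod.mk.injEq] at h
      rw [← Nat.ordProj_mul_ordCompl_eq_self m p, ← Nat.ordProj_mul_ordCompl_eq_self m' p]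
      rw [h.2, h.1]
    have hLnonneg : 0 ≤ ∑ k ∈ L, g (p ^ k) := Finset.sum_nonneg fun _ _ => hg0 _
    calc ∑ m ∈ S', g m = ∑ m ∈ S', G (φ m) := Finset.sum_congr rfl hgφ
      _ = ∑ x ∈ S'.image φ, G x := (Finset.sum_image hinj).symm
      _ ≤ ∑ x ∈ L ×ˢ S, G x :=
          Finset.sum_le_sum_of_subset_of_nonneg (Finset.image_subset_iff.2 hmaps) fun _ _ _ => hG0 _
      _ = (∑ k ∈ L, g (p ^ k)) * ∑ m ∈ S, g m := by
          rw [Finset.sum_product, Finset.sum_mul]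
          refine Finset.sum_congr rfl fun k _ => ?_
          rw [Finset.mul_sum]
      _ ≤ (∑ k ∈ L, g (p ^ k)) * ∏ q ∈ B, ∑ k ∈ Finset.range (Nat.log q T + 1), g (q ^ k) :=
          mul_le_mul_of_nonneg_left (ih hB') hLnonneg

/-! ### Character sums of `ψ_Δ` in arithmetic progressions -/

section CharSum

variable {N : ℕ} [NeZero N]

/-- `∑_{x < N} Re χ(x) = 0` for a non-principal Dirichlet character `χ` mod `N`. [folklore] -/
theorem sum_range_re_apply_eq_zero {χ : DirichletCharacter ℂ N} (hχ1 : χ ≠ 1) :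
    ∑ x ∈ Finset.range N, (χ (x : ZMod N)).re = 0 := by
  classical
  have hinj : Set.InjOn (fun x : ℕ => (x : ZMod N)) (Finset.range N) := by
    intro x hx y hy h
    rw [Finset.coe_range, Set.mem_Iio] at hx hy
    have := (ZMod.natCast_eq_natCast_iff' x y N).1 h
    rwa [Nat.mod_eq_of_lt hx, Nat.mod_eq_of_lt hy] at this
  have himg : (Finset.range N).image (fun x : ℕ => (x : ZMod N)) = Finset.univ := by
    apply Finset.eq_univ_of_card
    rw [Finset.card_image_of_injOn hinj, Finset.card_range, ZMod.card]
  calc ∑ x ∈ Finset.range N, (χ (x : ZMod N)).re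
      = ∑ y ∈ (Finset.range N).image (fun x : ℕ => (x : ZMod N)), (χ y).re :=
        (Finset.sum_image (f := fun y : ZMod N => (χ y).re) hinj).symm
    _ = ∑ y : ZMod N, (χ y).re := by rw [himg]
    _ = 0 := by rw [← Complex.re_sum, MulChar.sum_eq_zero_of_ne_one hχ1, Complex.zero_re]

/-- … and the same over `N` consecutive terms of a progression of difference prime to `N`. [folklore] -/
theorem sum_range_re_apply_ap_eq_zero {χ : DirichletCharacter ℂ N} (hχ1 : χ ≠ 1) {d : ℕ}
    (hd : d.Coprime N) (n₁ : ℕ) :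
    ∑ t ∈ Finset.range N, (χ ((n₁ + d * t : ℕ) : ZMod N)).re = 0 := by
  classical
  have hu : IsUnit (d : ZMod N) := (ZMod.isUnit_iff_coprime d N).2 hd
  have hinj : Set.InjOn (fun t : ℕ => ((n₁ + d * t : ℕ) : ZMod N)) (Finset.range N) := by
    intro x hx y hy h
    rw [Finset.coe_range, Set.mem_Iio] at hx hy
    have h' : (d : ZMod N) * x = (d : ZMod N) * y := by
      have := h; push_cast at this; exact add_left_cancel this
    have h'' : (x : ZMod N) = y := hu.mul_left_cancel h'
    have := (ZMod.natCast_eq_natCast_iff' x y N).1 h''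
    rwa [Nat.mod_eq_of_lt hx, Nat.mod_eq_of_lt hy] at this
  have himg : (Finset.range N).image (fun t : ℕ => ((n₁ + d * t : ℕ) : ZMod N)) = Finset.univ := by
    apply Finset.eq_univ_of_card
    rw [Finset.card_image_of_injOn hinj, Finset.card_range, ZMod.card]
  calc ∑ t ∈ Finset.range N, (χ ((n₁ + d * t : ℕ) : ZMod N)).re
      = ∑ y ∈ (Finset.range N).image (fun t : ℕ => ((n₁ + d * t : ℕ) : ZMod N)), (χ y).re :=
        (Finset.sum_image (f := fun y : ZMod N => (χ y).re) hinj).symm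
    _ = ∑ y : ZMod N, (χ y).re := by rw [himg]
    _ = 0 := by rw [← Complex.re_sum, MulChar.sum_eq_zero_of_ne_one hχ1, Complex.zero_re]

end CharSum

/-- `ψ_Δ = Re χ` for a Dirichlet character `χ` mod `4|Δ|` with `χ(n) = (Δ/n)` on odd `n`. [folklore] -/
theorem jacPsi_eq_re {Δ : ℤ} {χ : DirichletCharacter ℂ (4 * Δ.natAbs)}
    (hχ : ∀ n : ℕ, Odd n → χ n = (J(Δ | n) : ℂ)) (n : ℕ) :
    jacPsi Δ n = (χ (n : ZMod (4 * Δ.natAbs))).re := by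
  by_cases hn : Odd n
  · rw [jacPsi_of_odd hn, hχ n hn]; norm_cast
  · rw [jacPsi_of_even (Nat.not_odd_iff_even.1 hn)]
    have h2 : ¬ IsUnit ((n : ℕ) : ZMod (4 * Δ.natAbs)) := by
      rw [ZMod.isUnit_iff_coprime]
      intro hcop
      have h2n : 2 ∣ n := (Nat.not_odd_iff_even.1 hn).two_dvd
      have h24 : 2 ∣ 4 * Δ.natAbs := dvd_mul_of_dvd_left (by norm_num) _
      have := Nat.dvd_one.1 (hcop ▸ Nat.dvd_gcd h2n h24 : 2 ∣ 1)
      omega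
    rw [χ.map_nonunit h2, Complex.zero_re]

/-- **`∑_{t < N} ψ_Δ(n₁ + d t) = 0`** for `N = 4|Δ|`, `(d, N) = 1`, when `Δ` is the discriminant
of an irreducible `G = aX² + bX + c` with `a > 0`, `c` odd (the Kronecker character mod `4|Δ|` is
non-principal, `ne_one_of_forall_odd`). [folklore] -/
theorem sum_range_jacPsi_ap_eq_zero (ha : 0 < a) (hc : Odd c) (hirr : Irreducible (quadPoly a b c))
    {d : ℕ} (hd : d.Coprime (4 * (b ^ 2 - 4 * a * c).natAbs)) (n₁ : ℕ) :
    ∑ t ∈ Finset.range (4 * (b ^ 2 - 4 * a * c).natAbs), jacPsi (b ^ 2 - 4 * a * c) (n₁ + d * t) = 0 := by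
  have hΔ0 : b ^ 2 - 4 * a * c ≠ 0 := disc_ne_zero ha.ne' hirr
  obtain ⟨χ, hχ⟩ := Literature.NumberTheory.QuadraticFields.exists_dirichletCharacter_four_mul _ hΔ0
  haveI : NeZero (4 * (b ^ 2 - 4 * a * c).natAbs) :=
    ⟨mul_ne_zero (by norm_num) (Int.natAbs_ne_zero.2 hΔ0)⟩
  have hχ1 : χ ≠ 1 := ne_one_of_forall_odd ha hc hirr hχ
  simp_rw [jacPsi_eq_re hχ]
  exact sum_range_re_apply_ap_eq_zero hχ1 hd n₁

/-- The prefix sums `Ψ(x) = ∑_{n < x, n ≡ ν (d)} ψ_Δ(n)`. [folklore] -/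
def psiPrefix (Δ : ℤ) (d ν x : ℕ) : ℝ :=
  ∑ n ∈ (Finset.range x).filter (fun n => n ≡ ν [MOD d]), jacPsi Δ n

/-- The sum over one full period `[x, x + dN)` of the progression vanishes. [folklore] -/
theorem psiPrefix_add_period (ha : 0 < a) (hc : Odd c) (hirr : Irreducible (quadPoly a b c))
    {d : ℕ} (hd0 : 0 < d) (hd : d.Coprime (4 * (b ^ 2 - 4 * a * c).natAbs)) (ν x : ℕ) :
    psiPrefix (b ^ 2 - 4 * a * c) d ν (x + d * (4 * (b ^ 2 - 4 * a * c).natAbs)) =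
      psiPrefix (b ^ 2 - 4 * a * c) d ν x := by
  classical
  set N := 4 * (b ^ 2 - 4 * a * c).natAbs with hN
  set Δ := b ^ 2 - 4 * a * c
  unfold psiPrefix
  simp only [Finset.range_eq_Ico]
  rw [← Finset.Ico_union_Ico_eq_Ico (Nat.zero_le x) (Nat.le_add_right x _),
    Finset.filter_union, Finset.sum_union]
  swap
  · exact Finset.disjoint_filter_filter (Finset.Ico_disjoint_Ico_consecutive 0 x _)
  convert add_zero _
  -- the block `[x, x + dN)`: `n = x + s`, `s ≡ ν - x`, `s = s₀ + d t`
  set s₀ := (ν + d * x - x) % d with hs₀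
  have hs₀d : s₀ < d := Nat.mod_lt _ hd0
  have hdx : x ≤ d * x := Nat.le_mul_of_pos_left x hd0
  have hclass : ∀ s : ℕ, (x + s ≡ ν [MOD d] ↔ s ≡ s₀ [MOD d]) := by
    intro s
    have h1 : s₀ ≡ ν + d * x - x [MOD d] := Nat.mod_modEq _ _
    have h2 : ν + d * x ≡ ν [MOD d] := by rw [Nat.ModEq, Nat.add_mul_mod_self_left]
    have e3 : ν + d * x - x + x = ν + d * x := by omega
    constructor
    · intro h
      have h3 : s + x ≡ (ν + d * x - x) + x [MOD d] := by
        rw [e3, add_comm]; exact h.trans h2.symm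
      exact (Nat.ModEq.add_right_cancel' x h3).trans h1.symm
    · intro h
      have h3 := (h.trans h1).add_right x
      rw [e3, add_comm] at h3
      exact h3.trans h2
  have hreindex : ∑ n ∈ (Finset.Ico x (x + d * N)).filter (fun n => n ≡ ν [MOD d]), jacPsi Δ n =
      ∑ t ∈ Finset.range N, jacPsi Δ (x + s₀ + d * t) := by
    symm
    refine Finset.sum_nbij (fun t => x + s₀ + d * t) ?_ ?_ ?_ ?_
    · intro t ht
      rw [Finset.mem_range] at ht
      rw [Finset.mem_filter, Finset.mem_Ico]
      refine ⟨⟨by omega, ?_⟩, ?_⟩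
      · have : d * t + d ≤ d * N := by rw [← mul_add_one]; exact Nat.mul_le_mul_left d ht
        omega
      · rw [add_assoc, hclass]
        rw [Nat.ModEq, Nat.add_mul_mod_self_left]
    · intro t _ t' _ h
      simp only at h
      have : d * t = d * t' := by omega
      exact Nat.eq_of_mul_eq_mul_left hd0 this
    · intro n hn
      rw [Finset.mem_coe, Finset.mem_filter, Finset.mem_Ico] at hn
      obtain ⟨⟨h1, h2⟩, h3⟩ := hn
      rw [show n = x + (n - x) by omega, hclass, Nat.ModEq, Nat.mod_eq_of_lt hs₀d] at h3
      -- `n - x = s₀ + d t`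
      have h4 := Nat.div_add_mod (n - x) d
      rw [h3] at h4
      refine ⟨(n - x) / d, ?_, ?_⟩
      · rw [Finset.mem_coe, Finset.mem_range]
        by_contra hge
        push Not at hge
        have : d * N ≤ d * ((n - x) / d) := Nat.mul_le_mul_left d hge
        omega
      · dsimp only; omega
    · intro t _; rfl
  rw [hreindex]
  exact sum_range_jacPsi_ap_eq_zero ha hc hirr hd (x + s₀)

/-- **`|Ψ(x)| ≤ N`**: a period of the progression has exactly `N` terms. [folklore] -/
theorem abs_psiPrefix_le (ha : 0 < a) (hc : Odd c) (hirr : Irreducible (quadPoly a b c))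
    {d : ℕ} (hd0 : 0 < d) (hd : d.Coprime (4 * (b ^ 2 - 4 * a * c).natAbs)) (ν x : ℕ) :
    |psiPrefix (b ^ 2 - 4 * a * c) d ν x| ≤ 4 * (b ^ 2 - 4 * a * c).natAbs := by
  classical
  set N := 4 * (b ^ 2 - 4 * a * c).natAbs with hN
  have hN0 : 0 < N := by
    have := Int.natAbs_pos.2 (disc_ne_zero ha.ne' hirr); rw [hN]; omega
  -- reduce `x` below `dN`
  induction x using Nat.strong_induction_on with
  | _ x ih =>
    rcases lt_or_ge x (d * N) with hlt | hge
    · -- fewer than `N` terms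
      have hNR : (N : ℝ) = 4 * ((b ^ 2 - 4 * a * c).natAbs : ℝ) := by rw [hN]; push_cast; ring
      unfold psiPrefix
      refine (Finset.abs_sum_le_sum_abs _ _).trans ?_
      rw [← hNR]
      calc ∑ n ∈ (Finset.range x).filter (fun n => n ≡ ν [MOD d]), |jacPsi (b ^ 2 - 4 * a * c) n|
          ≤ ∑ n ∈ (Finset.range x).filter (fun n => n ≡ ν [MOD d]), (1 : ℝ) :=
            Finset.sum_le_sum fun n _ => abs_jacPsi_le_one _ _
        _ = (((Finset.range x).filter (fun n => n ≡ ν [MOD d])).card : ℝ) := by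
            rw [Finset.sum_const, nsmul_eq_mul, mul_one]
        _ ≤ (N : ℝ) := by
            have hcard : ((Finset.range x).filter (fun n => n ≡ ν [MOD d])).card ≤ N := by
              have hinj : Set.InjOn (fun n => n / d) ((Finset.range x).filter (fun n => n ≡ ν [MOD d])) := by
                intro n hn n' hn' h
                rw [Finset.coe_filter] at hn hn'
                have hm : n % d = n' % d := hn.2.trans hn'.2.symm
                simp only at h
                calc n = d * (n / d) + n % d := (Nat.div_add_mod n d).symm
                  _ = d * (n' / d) + n' % d := by rw [h, hm]
                  _ = n' := Nat.div_add_mod n' d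
              have hmaps : Set.MapsTo (fun n => n / d) ((Finset.range x).filter (fun n => n ≡ ν [MOD d]))
                  (Finset.range N) := by
                intro n hn
                rw [Finset.coe_filter] at hn
                rw [Finset.coe_range, Set.mem_Iio, Nat.div_lt_iff_lt_mul hd0]
                calc n < x := Finset.mem_range.1 hn.1
                  _ < d * N := hlt
                  _ = N * d := mul_comm _ _
              calc ((Finset.range x).filter (fun n => n ≡ ν [MOD d])).card ≤ (Finset.range N).card :=
                    Finset.card_le_card_of_injOn _ hmaps hinj
                _ = N := Finset.card_range N
            exact_mod_cast hcard
    · have hdN : 0 < d * N := Nat.mul_pos hd0 hN0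
      have e : x = (x - d * N) + d * N := by omega
      rw [e, psiPrefix_add_period ha hc hirr hd0 hd]
      exact ih _ (by omega)

/-- **`|∑_{A < n ≤ B, n ≡ ν (d)} ψ_Δ(n)| ≤ 2N`** (`N = 4|Δ|`, `(d, N) = 1`). [folklore] -/
theorem abs_sum_Ioc_jacPsi_modEq_le (ha : 0 < a) (hc : Odd c) (hirr : Irreducible (quadPoly a b c))
    {d : ℕ} (hd0 : 0 < d) (hd : d.Coprime (4 * (b ^ 2 - 4 * a * c).natAbs)) (ν A B : ℕ) :
    |∑ n ∈ (Finset.Ioc A B).filter (fun n => n ≡ ν [MOD d]), jacPsi (b ^ 2 - 4 * a * c) n| ≤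
      2 * (4 * (b ^ 2 - 4 * a * c).natAbs) := by
  classical
  rcases le_or_gt B A with hBA | hAB
  · rw [Finset.Ioc_eq_empty (by omega), Finset.filter_empty, Finset.sum_empty, abs_zero]; positivity
  have hsplit : ∑ n ∈ (Finset.Ioc A B).filter (fun n => n ≡ ν [MOD d]), jacPsi (b ^ 2 - 4 * a * c) n =
      psiPrefix (b ^ 2 - 4 * a * c) d ν (B + 1) - psiPrefix (b ^ 2 - 4 * a * c) d ν (A + 1) := by
    unfold psiPrefix
    rw [Finset.range_eq_Ico, Finset.range_eq_Ico,
      ← Finset.Ico_union_Ico_eq_Ico (Nat.zero_le (A + 1)) (by omega : A + 1 ≤ B + 1),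
      Finset.filter_union, Finset.sum_union
        (Finset.disjoint_filter_filter (Finset.Ico_disjoint_Ico_consecutive 0 (A + 1) (B + 1))),
      add_sub_cancel_left]
    have hI : Finset.Ico (A + 1) (B + 1) = Finset.Ioc A B := by
      ext n; simp only [Finset.mem_Ico, Finset.mem_Ioc]; omega
    rw [hI]
  rw [hsplit]
  have h1 := abs_psiPrefix_le ha hc hirr hd0 hd ν (B + 1)
  have h2 := abs_psiPrefix_le ha hc hirr hd0 hd ν (A + 1)
  calc |psiPrefix (b ^ 2 - 4 * a * c) d ν (B + 1) - psiPrefix (b ^ 2 - 4 * a * c) d ν (A + 1)|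
      ≤ |psiPrefix (b ^ 2 - 4 * a * c) d ν (B + 1)| + |psiPrefix (b ^ 2 - 4 * a * c) d ν (A + 1)| :=
        abs_sub _ _
    _ ≤ _ := by linarith

/-! ### Counting integers prime to `Q'` in a progression -/

/-- `#{1 ≤ f ≤ W : (f, Q') = 1, f ≡ ν (mod d)}`. [folklore] -/
def copCount (W Q' d ν : ℕ) : ℕ :=
  ((Finset.Ioc 0 W).filter (fun f => f.Coprime Q' ∧ f ≡ ν [MOD d])).card

/-- **`#{f ≤ W : (f, Q') = 1, f ≡ ν (d)} = (φ(Q')/Q') W/d + O(τ(Q'))`** for `(Q', d) = 1`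
(Möbius over the divisors of `Q'`, one residue class modulo `hd` for each `h ∣ Q'`). [folklore] -/
theorem abs_copCount_sub_le {W Q' d ν : ℕ} (hQ' : Q' ≠ 0) (hd : 0 < d) (hQ'd : Q'.Coprime d) :
    |(copCount W Q' d ν : ℝ) - (Nat.totient Q' : ℝ) / Q' * W / d| ≤ Q'.divisors.card := by
  classical
  -- Möbius detection of the coprimality
  have h1 : (copCount W Q' d ν : ℝ) = ∑ h ∈ Q'.divisors, (ArithmeticFunction.moebius h : ℝ) *
      (dvdCongrCount W h d 1 ν : ℝ) := by
    unfold copCount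
    rw [Finset.card_eq_sum_ones, Nat.cast_sum, Finset.sum_filter]
    push_cast
    have hstep : ∀ f ∈ Finset.Ioc 0 W, (if f.Coprime Q' ∧ f ≡ ν [MOD d] then (1 : ℝ) else 0) =
        ∑ h ∈ Q'.divisors, (if h ∣ f ∧ f ≡ ν [MOD d] then (ArithmeticFunction.moebius h : ℝ) else 0) := by
      intro f hf
      rw [Finset.mem_Ioc] at hf
      have hf0 : f ≠ 0 := by omega
      by_cases hν : f ≡ ν [MOD d]
      · have := ite_coprime_eq_sum_moebius hf0 hQ'
        simp only [hν, and_true]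
        rw [this, Finset.sum_filter]
      · simp only [hν, and_false, if_false, Finset.sum_const_zero]
    rw [Finset.sum_congr rfl hstep, Finset.sum_comm]
    refine Finset.sum_congr rfl fun h _ => ?_
    unfold dvdCongrCount
    rw [Finset.card_eq_sum_ones, Nat.cast_sum, Finset.sum_filter]
    push_cast
    rw [Finset.mul_sum]
    refine Finset.sum_congr rfl fun f _ => ?_
    simp only [mul_one]
    split_ifs <;> simp
  -- the main term
  have h2 : (Nat.totient Q' : ℝ) / Q' * W / d =
      ∑ h ∈ Q'.divisors, (ArithmeticFunction.moebius h : ℝ) * ((W : ℝ) / (h * d)) := by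
    rw [← sum_divisors_moebius_div_eq Q' hQ', Finset.sum_mul, Finset.sum_div]
    refine Finset.sum_congr rfl fun h hh => ?_
    have hh0 : (h : ℝ) ≠ 0 := by exact_mod_cast (Nat.pos_of_mem_divisors hh).ne'
    have hd0 : (d : ℝ) ≠ 0 := by exact_mod_cast hd.ne'
    field_simp
  rw [h1, h2, ← Finset.sum_sub_distrib]
  refine (Finset.abs_sum_le_sum_abs _ _).trans ?_
  have h3 : ∀ h ∈ Q'.divisors, |(ArithmeticFunction.moebius h : ℝ) * (dvdCongrCount W h d 1 ν : ℝ) -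
      (ArithmeticFunction.moebius h : ℝ) * ((W : ℝ) / (h * d))| ≤ 1 := by
    intro h hh
    have hh0 : 0 < h := Nat.pos_of_mem_divisors hh
    have hhd : h.Coprime d := Nat.Coprime.coprime_dvd_left (Nat.dvd_of_mem_divisors hh) hQ'd
    rw [← mul_sub, abs_mul]
    have hμ : |(ArithmeticFunction.moebius h : ℝ)| ≤ 1 := by
      exact_mod_cast ArithmeticFunction.abs_moebius_le_one
    have hc := abs_dvdCongrCount_sub_le (W := W) (μ := ν) hh0 hd hhd (Nat.coprime_one_left d)
    calc |(ArithmeticFunction.moebius h : ℝ)| * |(dvdCongrCount W h d 1 ν : ℝ) - (W : ℝ) / (h * d)|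
        ≤ 1 * 1 := mul_le_mul hμ hc (abs_nonneg _) zero_le_one
      _ = 1 := one_mul 1
  calc ∑ h ∈ Q'.divisors, |(ArithmeticFunction.moebius h : ℝ) * (dvdCongrCount W h d 1 ν : ℝ) -
        (ArithmeticFunction.moebius h : ℝ) * ((W : ℝ) / (h * d))|
      ≤ ∑ h ∈ Q'.divisors, (1 : ℝ) := Finset.sum_le_sum h3
    _ = Q'.divisors.card := by rw [Finset.sum_const, nsmul_eq_mul, mul_one]

/-! ### Character sums with coprimality and congruence conditions -/

/-- Re-indexing `e = h e'` under a divisibility and a congruence condition. [folklore] -/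
theorem sum_filter_dvd_modEq_Ioc_eq {h : ℕ} (hh : 0 < h) (A B d ν : ℕ) (g : ℕ → ℝ) :
    ∑ e ∈ (Finset.Ioc A B).filter (fun e => h ∣ e ∧ e ≡ ν [MOD d]), g e =
      ∑ e' ∈ (Finset.Ioc (A / h) (B / h)).filter (fun e' => h * e' ≡ ν [MOD d]), g (h * e') := by
  classical
  rw [← Finset.filter_filter, Finset.sum_filter, sum_filter_dvd_Ioc_eq hh, Finset.sum_filter]

/-- **`|∑_{A < e ≤ B, (e, Q') = 1, e ≡ ν (d)} ψ_Δ(e)| ≤ 2N τ(Q')`** for `(Q', d) = 1`, `(d, N) = 1`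
(`N = 4|Δ|`; Möbius over `h ∣ Q'`, `ψ_Δ(h e') = ψ_Δ(h) ψ_Δ(e')`, and the progression bound). [folklore] -/
theorem abs_sum_jacPsi_coprime_modEq_le (ha : 0 < a) (hc : Odd c) (hirr : Irreducible (quadPoly a b c))
    {Q' d : ℕ} (hQ' : Q' ≠ 0) (hd0 : 0 < d) (hQ'd : Q'.Coprime d)
    (hd : d.Coprime (4 * (b ^ 2 - 4 * a * c).natAbs)) (ν A B : ℕ) :
    |∑ e ∈ (Finset.Ioc A B).filter (fun e => e.Coprime Q' ∧ e ≡ ν [MOD d]), jacPsi (b ^ 2 - 4 * a * c) e| ≤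
      2 * (4 * (b ^ 2 - 4 * a * c).natAbs) * Q'.divisors.card := by
  classical
  set Δ := b ^ 2 - 4 * a * c with hΔ
  set N := 4 * Δ.natAbs with hN
  -- Möbius detection
  have h1 : ∑ e ∈ (Finset.Ioc A B).filter (fun e => e.Coprime Q' ∧ e ≡ ν [MOD d]), jacPsi Δ e =
      ∑ h ∈ Q'.divisors, (ArithmeticFunction.moebius h : ℝ) *
        ∑ e ∈ (Finset.Ioc A B).filter (fun e => h ∣ e ∧ e ≡ ν [MOD d]), jacPsi Δ e := by
    rw [Finset.sum_filter]
    have hstep : ∀ e ∈ Finset.Ioc A B, (if e.Coprime Q' ∧ e ≡ ν [MOD d] then jacPsi Δ e else 0) =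
        ∑ h ∈ Q'.divisors, (ArithmeticFunction.moebius h : ℝ) *
          (if h ∣ e ∧ e ≡ ν [MOD d] then jacPsi Δ e else 0) := by
      intro e he
      rw [Finset.mem_Ioc] at he
      have he0 : e ≠ 0 := by omega
      by_cases hν : e ≡ ν [MOD d]
      · simp only [hν, and_true]
        have := ite_coprime_eq_sum_moebius (a := e) he0 hQ'
        rw [Finset.sum_filter] at this
        have key : (if e.Coprime Q' then jacPsi Δ e else 0) =
            (if e.Coprime Q' then (1 : ℝ) else 0) * jacPsi Δ e := by split_ifs <;> simp
        rw [key, this, Finset.sum_mul]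
        refine Finset.sum_congr rfl fun h _ => ?_
        split_ifs <;> simp
      · simp only [hν, and_false, if_false, mul_zero, Finset.sum_const_zero]
    rw [Finset.sum_congr rfl hstep, Finset.sum_comm]
    refine Finset.sum_congr rfl fun h _ => ?_
    rw [Finset.mul_sum, Finset.sum_filter]
    refine Finset.sum_congr rfl fun e _ => ?_
    simp only [mul_ite, mul_zero]
  rw [h1]
  -- each inner sum is at most `2N`
  have h2 : ∀ h ∈ Q'.divisors, |(ArithmeticFunction.moebius h : ℝ) *
      ∑ e ∈ (Finset.Ioc A B).filter (fun e => h ∣ e ∧ e ≡ ν [MOD d]), jacPsi Δ e| ≤ 2 * N := by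
    intro h hh
    have hh0 : 0 < h := Nat.pos_of_mem_divisors hh
    have hhd : h.Coprime d := Nat.Coprime.coprime_dvd_left (Nat.dvd_of_mem_divisors hh) hQ'd
    obtain ⟨ν', hν'⟩ := exists_mul_modEq_iff hd0 hhd ν
    rw [sum_filter_dvd_modEq_Ioc_eq hh0]
    have hre : (Finset.Ioc (A / h) (B / h)).filter (fun e' => h * e' ≡ ν [MOD d]) =
        (Finset.Ioc (A / h) (B / h)).filter (fun e' => e' ≡ ν' [MOD d]) := by
      refine Finset.filter_congr fun e' _ => ?_
      rw [mul_comm, hν' e']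
    rw [hre]
    have hmul : ∑ e' ∈ (Finset.Ioc (A / h) (B / h)).filter (fun e' => e' ≡ ν' [MOD d]), jacPsi Δ (h * e') =
        jacPsi Δ h * ∑ e' ∈ (Finset.Ioc (A / h) (B / h)).filter (fun e' => e' ≡ ν' [MOD d]), jacPsi Δ e' := by
      rw [Finset.mul_sum]
      exact Finset.sum_congr rfl fun e' _ => jacPsi_mul Δ h e'
    rw [hmul, ← mul_assoc, abs_mul, abs_mul]
    have hμ : |(ArithmeticFunction.moebius h : ℝ)| ≤ 1 := by
      exact_mod_cast ArithmeticFunction.abs_moebius_le_one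
    have hψ := abs_jacPsi_le_one Δ h
    have hsum := abs_sum_Ioc_jacPsi_modEq_le ha hc hirr hd0 hd ν' (A / h) (B / h)
    have hNR : (4 * (Δ.natAbs : ℝ)) = (N : ℝ) := by rw [hN]; push_cast; ring
    rw [hNR] at hsum
    calc |(ArithmeticFunction.moebius h : ℝ)| * |jacPsi Δ h| *
          |∑ e' ∈ (Finset.Ioc (A / h) (B / h)).filter (fun e' => e' ≡ ν' [MOD d]), jacPsi Δ e'|
        ≤ 1 * 1 * (2 * N) := by
          refine mul_le_mul (mul_le_mul hμ hψ (abs_nonneg _) zero_le_one) hsum (abs_nonneg _) ?_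
          positivity
      _ = 2 * N := by ring
  refine (Finset.abs_sum_le_sum_abs _ _).trans ?_
  calc ∑ h ∈ Q'.divisors, |(ArithmeticFunction.moebius h : ℝ) *
        ∑ e ∈ (Finset.Ioc A B).filter (fun e => h ∣ e ∧ e ≡ ν [MOD d]), jacPsi Δ e|
      ≤ ∑ h ∈ Q'.divisors, (2 * N : ℝ) := Finset.sum_le_sum h2
    _ = 2 * N * Q'.divisors.card := by rw [Finset.sum_const, nsmul_eq_mul]; ring
    _ = _ := by rw [hN]; push_cast; ring

/-- Integers prime to a number `Q₁` whose prime factors include the bad primes are odd and prime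
to `Δ`. [folklore] -/
theorem odd_and_gcd_eq_one_of_coprime (ha : 0 < a) (hirr : Irreducible (quadPoly a b c)) {Q₁ g : ℕ}
    (hsub : (badMod a b c).primeFactors ⊆ Q₁.primeFactors) (hg : g.Coprime Q₁) :
    Odd g ∧ Int.gcd (b ^ 2 - 4 * a * c) g = 1 := by
  have hD0 := badMod_ne_zero ha hirr
  -- every prime factor of `badMod` does not divide `g`
  have hkey : ∀ p : ℕ, p.Prime → p ∣ badMod a b c → ¬ p ∣ g := by
    intro p hp hpD hpg
    have hpQ : p ∈ Q₁.primeFactors := hsub (Nat.mem_primeFactors.2 ⟨hp, hpD, hD0⟩)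
    have hpQ' := (Nat.mem_primeFactors.1 hpQ).2.1
    have h1 : p ∣ Nat.gcd g Q₁ := Nat.dvd_gcd hpg hpQ'
    rw [hg] at h1
    exact hp.one_lt.ne' (Nat.dvd_one.1 h1)
  have h2D : 2 ∣ badMod a b c := by
    unfold badMod
    rw [← Int.natCast_dvd]; push_cast
    exact dvd_mul_of_dvd_left (dvd_mul_right 2 a) _
  have hΔD : (b ^ 2 - 4 * a * c).natAbs ∣ badMod a b c := by
    unfold badMod
    rw [Int.natAbs_mul]
    exact dvd_mul_left _ _
  refine ⟨?_, ?_⟩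
  · rw [Nat.odd_iff]
    have := hkey 2 Nat.prime_two h2D
    omega
  · rw [Int.gcd_eq_natAbs, Int.natAbs_natCast]
    by_contra hne
    obtain ⟨p, hp, hpg⟩ := Nat.exists_prime_and_dvd hne
    have hp1 : p ∣ (b ^ 2 - 4 * a * c).natAbs := hpg.trans (Nat.gcd_dvd_left _ _)
    have hp2 : p ∣ g := hpg.trans (Nat.gcd_dvd_right _ _)
    exact hkey p hp (hp1.trans hΔD) hp2

/-- **The squarefree version**: for `(Q₁, d) = 1`, `(d, N) = 1`, `(ν, d) = 1` and `Q₁` divisible by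
every bad prime,
`|∑_{A < e ≤ B, e squarefree, (e, Q₁) = 1, e ≡ ν (d)} ψ_Δ(e)| ≤ ⌊√B⌋ · 2N τ(Q₁)`
(`μ²(e) = ∑_{g² ∣ e} μ(g)`, `e = g²e'`, `ψ_Δ(g²) = 1`, and the previous lemma for each `g ≤ √B`).
[folklore] -/
theorem abs_sum_jacPsi_sqf_coprime_modEq_le (ha : 0 < a) (hc : Odd c) (hirr : Irreducible (quadPoly a b c))
    {Q₁ d : ℕ} (hQ₁ : Q₁ ≠ 0) (hd0 : 0 < d) (hQ₁d : Q₁.Coprime d)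
    (hd : d.Coprime (4 * (b ^ 2 - 4 * a * c).natAbs))
    (hsub : (badMod a b c).primeFactors ⊆ Q₁.primeFactors) {ν : ℕ} (hν : ν.Coprime d) (A B : ℕ) :
    |∑ e ∈ (Finset.Ioc A B).filter (fun e => Squarefree e ∧ e.Coprime Q₁ ∧ e ≡ ν [MOD d]),
        jacPsi (b ^ 2 - 4 * a * c) e| ≤
      Nat.sqrt B * (2 * (4 * (b ^ 2 - 4 * a * c).natAbs) * Q₁.divisors.card) := by
  classical
  set Δ := b ^ 2 - 4 * a * c with hΔ
  set M : ℝ := 2 * (4 * (Δ.natAbs : ℝ)) * Q₁.divisors.card with hM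
  have hM0 : 0 ≤ M := by positivity
  -- the inner sums `T(g)`
  set T : ℕ → ℝ := fun g => ∑ e ∈ (Finset.Ioc A B).filter
    (fun e => g ^ 2 ∣ e ∧ (e.Coprime Q₁ ∧ e ≡ ν [MOD d])), jacPsi Δ e with hT
  -- Step 1: `μ²` detection and interchange
  have h1 : ∑ e ∈ (Finset.Ioc A B).filter (fun e => Squarefree e ∧ e.Coprime Q₁ ∧ e ≡ ν [MOD d]),
      jacPsi Δ e = ∑ g ∈ Finset.Ioc 0 B, (ArithmeticFunction.moebius g : ℝ) * T g := by
    have hlhs : ∑ e ∈ (Finset.Ioc A B).filter (fun e => Squarefree e ∧ e.Coprime Q₁ ∧ e ≡ ν [MOD d]),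
        jacPsi Δ e = ∑ e ∈ (Finset.Ioc A B).filter (fun e => e.Coprime Q₁ ∧ e ≡ ν [MOD d]),
          (if Squarefree e then (1 : ℝ) else 0) * jacPsi Δ e := by
      rw [Finset.sum_filter, Finset.sum_filter]
      refine Finset.sum_congr rfl fun e _ => ?_
      by_cases h1 : Squarefree e
      · by_cases h2 : e.Coprime Q₁ ∧ e ≡ ν [MOD d]
        · rw [if_pos ⟨h1, h2⟩, if_pos h2, if_pos h1, one_mul]
        · rw [if_neg (fun h => h2 h.2), if_neg h2]
      · rw [if_neg (fun h => h1 h.1)]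
        split_ifs <;> simp
    rw [hlhs]
    have hstep : ∀ e ∈ (Finset.Ioc A B).filter (fun e => e.Coprime Q₁ ∧ e ≡ ν [MOD d]),
        (if Squarefree e then (1 : ℝ) else 0) * jacPsi Δ e =
          ∑ g ∈ Finset.Ioc 0 B, (if g ^ 2 ∣ e then (ArithmeticFunction.moebius g : ℝ) else 0) *
            jacPsi Δ e := by
      intro e he
      rw [Finset.mem_filter, Finset.mem_Ioc] at he
      rw [← sum_moebius_filter_sq_dvd (by omega : 0 < e) he.1.2, Finset.sum_filter, Finset.sum_mul]
    rw [Finset.sum_congr rfl hstep, Finset.sum_comm]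
    refine Finset.sum_congr rfl fun g _ => ?_
    simp only [hT]
    rw [Finset.mul_sum, Finset.sum_filter, Finset.sum_filter]
    refine Finset.sum_congr rfl fun e _ => ?_
    by_cases h1 : g ^ 2 ∣ e <;> by_cases h2 : (e.Coprime Q₁ ∧ e ≡ ν [MOD d]) <;> simp [h1, h2]
  -- Step 2: `T(g) = 0` for `g > √B`
  have h2 : ∀ g, Nat.sqrt B < g → T g = 0 := by
    intro g hg
    simp only [hT]
    refine Finset.sum_eq_zero fun e he => ?_
    exfalso
    rw [Finset.mem_filter, Finset.mem_Ioc] at he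
    have h1 : g ^ 2 ≤ e := Nat.le_of_dvd (by omega) he.2.1
    have h2 : B < g ^ 2 := Nat.sqrt_lt'.1 hg
    omega
  -- Step 3: `|T(g)| ≤ M` for every `g ≥ 1`
  have h3 : ∀ g, 0 < g → |T g| ≤ M := by
    intro g hg0
    simp only [hT]
    by_cases hgQ : g.Coprime Q₁
    · by_cases hgd : g.Coprime d
      · -- re-index `e = g² e'`
        have hg2 : 0 < g ^ 2 := pow_pos hg0 2
        have hg2d : (g ^ 2).Coprime d := Nat.Coprime.pow_left 2 hgd
        obtain ⟨ν', hν'⟩ := exists_mul_modEq_iff hd0 hg2d ν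
        obtain ⟨hgodd, hgΔ⟩ := odd_and_gcd_eq_one_of_coprime ha hirr hsub hgQ
        have hψg : jacPsi Δ (g ^ 2) = 1 := by rw [sq, jacPsi_mul, ← sq]; exact jacPsi_sq_eq_one hgodd hgΔ
        have hre : ∑ e ∈ (Finset.Ioc A B).filter (fun e => g ^ 2 ∣ e ∧ (e.Coprime Q₁ ∧ e ≡ ν [MOD d])),
            jacPsi Δ e = ∑ e' ∈ (Finset.Ioc (A / g ^ 2) (B / g ^ 2)).filter
              (fun e' => e'.Coprime Q₁ ∧ e' ≡ ν' [MOD d]), jacPsi Δ e' := by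
          have := sum_filter_dvd_Ioc_eq hg2 A B
            (fun e => if e.Coprime Q₁ ∧ e ≡ ν [MOD d] then jacPsi Δ e else 0)
          rw [← Finset.filter_filter, Finset.sum_filter, this, Finset.sum_filter]
          refine Finset.sum_congr rfl fun e' _ => ?_
          have hiff : ((g ^ 2 * e').Coprime Q₁ ∧ g ^ 2 * e' ≡ ν [MOD d]) ↔
              (e'.Coprime Q₁ ∧ e' ≡ ν' [MOD d]) := by
            rw [Nat.coprime_mul_iff_left, mul_comm, hν' e']
            exact ⟨fun h => ⟨h.1.2, h.2⟩, fun h => ⟨⟨Nat.Coprime.pow_left 2 hgQ, h.1⟩, h.2⟩⟩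
          simp only [hiff]
          split_ifs
          · rw [jacPsi_mul, hψg, one_mul]
          · rfl
        rw [hre]
        have := abs_sum_jacPsi_coprime_modEq_le ha hc hirr hQ₁ hd0 hQ₁d hd ν' (A / g ^ 2) (B / g ^ 2)
        simpa only [hM] using this
      · -- a common prime of `g` and `d` would divide `ν`: the sum is empty
        rw [Finset.sum_eq_zero]
        · rw [abs_zero]; exact hM0
        intro e he
        exfalso
        rw [Finset.mem_filter] at he
        obtain ⟨-, hge, -, heν⟩ := he
        apply hgd
        rw [Nat.coprime_iff_gcd_eq_one]
        by_contra hne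
        obtain ⟨p, hp, hpg⟩ := Nat.exists_prime_and_dvd hne
        have hpg' : p ∣ g := hpg.trans (Nat.gcd_dvd_left _ _)
        have hpd : p ∣ d := hpg.trans (Nat.gcd_dvd_right _ _)
        have hpe : p ∣ e := (hpg'.trans (dvd_pow_self g two_ne_zero)).trans hge
        have hpν : p ∣ ν := by
          have h1 : e ≡ ν [MOD p] := Nat.ModEq.of_dvd hpd heν
          have h2 : ν ≡ 0 [MOD p] := h1.symm.trans (Nat.modEq_zero_iff_dvd.2 hpe)
          exact Nat.modEq_zero_iff_dvd.1 h2
        have : p ∣ Nat.gcd ν d := Nat.dvd_gcd hpν hpd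
        rw [hν] at this
        exact hp.one_lt.ne' (Nat.dvd_one.1 this)
    · -- `g` not prime to `Q₁`: the sum is empty
      rw [Finset.sum_eq_zero]
      · rw [abs_zero]; exact hM0
      intro e he
      exfalso
      rw [Finset.mem_filter] at he
      obtain ⟨-, hge, heQ, -⟩ := he
      exact hgQ (Nat.Coprime.coprime_dvd_left ((dvd_pow_self g two_ne_zero).trans hge) heQ)
  -- Step 4: assemble
  rw [h1]
  have hsplit : Finset.Ioc 0 B = Finset.Ioc 0 (Nat.sqrt B) ∪ Finset.Ioc (Nat.sqrt B) B := by
    rw [Finset.Ioc_union_Ioc_eq_Ioc (Nat.zero_le _) (Nat.sqrt_le_self B)]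
  have hdisj : Disjoint (Finset.Ioc 0 (Nat.sqrt B)) (Finset.Ioc (Nat.sqrt B) B) :=
    Finset.Ioc_disjoint_Ioc_of_le le_rfl
  rw [hsplit, Finset.sum_union hdisj]
  have hzero : ∑ g ∈ Finset.Ioc (Nat.sqrt B) B, (ArithmeticFunction.moebius g : ℝ) * T g = 0 := by
    refine Finset.sum_eq_zero fun g hg => ?_
    rw [Finset.mem_Ioc] at hg
    rw [h2 g hg.1, mul_zero]
  rw [hzero, add_zero]
  refine (Finset.abs_sum_le_sum_abs _ _).trans ?_
  have h4 : ∀ g ∈ Finset.Ioc 0 (Nat.sqrt B), |(ArithmeticFunction.moebius g : ℝ) * T g| ≤ M := by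
    intro g hg
    rw [Finset.mem_Ioc] at hg
    rw [abs_mul]
    have hμ : |(ArithmeticFunction.moebius g : ℝ)| ≤ 1 := by
      exact_mod_cast ArithmeticFunction.abs_moebius_le_one
    calc |(ArithmeticFunction.moebius g : ℝ)| * |T g| ≤ 1 * M :=
          mul_le_mul hμ (h3 g hg.1) (abs_nonneg _) zero_le_one
      _ = M := one_mul M
  calc ∑ g ∈ Finset.Ioc 0 (Nat.sqrt B), |(ArithmeticFunction.moebius g : ℝ) * T g|
      ≤ ∑ g ∈ Finset.Ioc 0 (Nat.sqrt B), M := Finset.sum_le_sum h4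
    _ = Nat.sqrt B * M := by rw [Finset.sum_const, Nat.card_Ioc, nsmul_eq_mul]; simp
    _ = _ := by rw [hM]

/-! ### Splitting off the bad part: `ρ_G = (ρ_G·1_smooth) ⋆ (ρ_G·1_good)` -/

/-- The indicator of the `D`-smooth numbers (all prime factors divide `D`), `n ≥ 1`. [folklore] -/
def smoothInd (D : ℕ) : ArithmeticFunction ℝ :=
  ⟨fun n => if 0 < n ∧ n.primeFactors ⊆ D.primeFactors then 1 else 0, by simp⟩

/-- Unfolding `smoothInd`. [folklore] -/
theorem smoothInd_apply (D n : ℕ) :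
    smoothInd D n = if 0 < n ∧ n.primeFactors ⊆ D.primeFactors then 1 else 0 := rfl

/-- `1_{D-smooth}` is multiplicative. [folklore] -/
theorem isMultiplicative_smoothInd (D : ℕ) : (smoothInd D).IsMultiplicative := by
  refine ⟨by simp [smoothInd_apply], fun {m n} _ => ?_⟩
  simp only [smoothInd_apply]
  rcases Nat.eq_zero_or_pos m with rfl | hm
  · simp
  rcases Nat.eq_zero_or_pos n with rfl | hn
  · simp
  simp only [Nat.primeFactors_mul hm.ne' hn.ne', Finset.union_subset_iff]
  by_cases h1 : m.primeFactors ⊆ D.primeFactors <;> by_cases h2 : n.primeFactors ⊆ D.primeFactors <;>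
    simp [h1, h2, hm, hn]

/-- **`ρ_G = (ρ_G · 1_{D-smooth}) ⋆ (ρ_G · 1_{(·,D)=1})`** for `D ≠ 0` (every `m ≥ 1` factors
uniquely as a `D`-smooth number times a number prime to `D`, and `ρ_G` is multiplicative). [folklore] -/
theorem rhoGArith_eq_smooth_mul_good {D : ℕ} (hD : D ≠ 0) :
    rhoGArith a b c = (rhoGArith a b c).pmul (smoothInd D) * (rhoGArith a b c).pmul (copInd D) := by
  have hL : (rhoGArith a b c).IsMultiplicative := isMultiplicative_rhoGArith
  have hR : ((rhoGArith a b c).pmul (smoothInd D) * (rhoGArith a b c).pmul (copInd D)).IsMultiplicative :=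
    (isMultiplicative_rhoGArith.pmul (isMultiplicative_smoothInd D)).mul
      (isMultiplicative_rhoGArith.pmul (isMultiplicative_copInd D))
  rw [ArithmeticFunction.IsMultiplicative.eq_iff_eq_on_prime_powers _ hL _ hR]
  intro p k hp
  rw [mul_apply_prime_pow _ _ hp]
  simp only [ArithmeticFunction.pmul_apply, smoothInd_apply, copInd_apply, rhoGArith_apply]
  rcases Nat.eq_zero_or_pos k with rfl | hk
  · simp [rhoG_one]
  by_cases hpD : p ∣ D
  · -- only `i = k` survives
    rw [Finset.sum_eq_single_of_mem k (Finset.mem_range.2 (Nat.lt_succ_self k))]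
    · have h1 : 0 < p ^ k ∧ (p ^ k).primeFactors ⊆ D.primeFactors := by
        refine ⟨pow_pos hp.pos k, ?_⟩
        rw [Nat.primeFactors_prime_pow hk.ne' hp, Finset.singleton_subset_iff]
        exact Nat.mem_primeFactors.2 ⟨hp, hpD, hD⟩
      have h2 : 0 < p ^ (k - k) ∧ (p ^ (k - k)).Coprime D := by
        rw [Nat.sub_self, pow_zero]; exact ⟨Nat.one_pos, Nat.coprime_one_left D⟩
      rw [if_pos h1, if_pos h2, Nat.sub_self, pow_zero, rhoG_one]; push_cast; ring
    · intro i hi hik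
      rw [Finset.mem_range] at hi
      have hki : 0 < k - i := by omega
      have hnc : ¬ (0 < p ^ (k - i) ∧ (p ^ (k - i)).Coprime D) := by
        rintro ⟨-, hcop⟩
        have := Nat.Coprime.coprime_dvd_left (dvd_pow_self p hki.ne') hcop
        exact (Nat.Prime.coprime_iff_not_dvd hp).1 this hpD
      rw [if_neg hnc]; ring
  · -- only `i = 0` survives
    rw [Finset.sum_eq_single_of_mem 0 (Finset.mem_range.2 (Nat.succ_pos k))]
    · have h1 : 0 < p ^ 0 ∧ (p ^ 0).primeFactors ⊆ D.primeFactors := by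
        rw [pow_zero]; exact ⟨Nat.one_pos, by simp⟩
      have h2 : 0 < p ^ (k - 0) ∧ (p ^ (k - 0)).Coprime D :=
        ⟨pow_pos hp.pos _, Nat.Coprime.pow_left _ ((Nat.Prime.coprime_iff_not_dvd hp).2 hpD)⟩
      rw [if_pos h1, if_pos h2, pow_zero, rhoG_one, Nat.sub_zero]; push_cast; ring
    · intro i hi hi0
      rw [Finset.mem_range] at hi
      have hns : ¬ (0 < p ^ i ∧ (p ^ i).primeFactors ⊆ D.primeFactors) := by
        rintro ⟨-, hsub⟩
        rw [Nat.primeFactors_prime_pow hi0 hp, Finset.singleton_subset_iff] at hsub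
        exact hpD (Nat.mem_primeFactors.1 hsub).2.1
      rw [if_neg hns]; ring

/-- **The splitting of a weighted sum of `ρ_G` into bad and good parts**:
`∑_{m ≤ Y} ρ_G(m) w(m) = ∑_{s ≤ Y, s D-smooth} ρ_G(s) ∑_{t ≤ Y/s, (t, D) = 1} ρ_G(t) w(st)`. [folklore] -/
theorem sum_rhoG_mul_eq_sum_smooth_sum_good {D : ℕ} (hD : D ≠ 0) (Y : ℕ) (w : ℕ → ℝ) :
    ∑ m ∈ Finset.Icc 1 Y, (rhoG a b c m : ℝ) * w m =
      ∑ s ∈ Finset.Icc 1 Y, (if s.primeFactors ⊆ D.primeFactors then (rhoG a b c s : ℝ) else 0) *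
        ∑ t ∈ Finset.Icc 1 (Y / s), (if t.Coprime D then (rhoG a b c t : ℝ) else 0) * w (s * t) := by
  simp only [Finset.mul_sum]
  rw [← SquarefreeSums.sum_Icc_sum_divisorsAntidiagonal (fun s t =>
    (if s.primeFactors ⊆ D.primeFactors then (rhoG a b c s : ℝ) else 0) *
      ((if t.Coprime D then (rhoG a b c t : ℝ) else 0) * w (s * t))) Y]
  · refine Finset.sum_congr rfl fun m hm => ?_
    rw [Finset.mem_Icc] at hm
    have h := congrArg (fun F : ArithmeticFunction ℝ => F m) (rhoGArith_eq_smooth_mul_good (a := a)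
      (b := b) (c := c) hD)
    simp only [rhoGArith_apply, ArithmeticFunction.mul_apply, ArithmeticFunction.pmul_apply,
      smoothInd_apply, copInd_apply] at h
    rw [h, Finset.sum_mul]
    refine Finset.sum_congr rfl fun q hq => ?_
    rw [Nat.mem_divisorsAntidiagonal] at hq
    have hq1 : 0 < q.1 := Nat.pos_of_ne_zero (fun h0 => by rw [h0, zero_mul] at hq; omega)
    have hq2 : 0 < q.2 := Nat.pos_of_ne_zero (fun h0 => by rw [h0, mul_zero] at hq; omega)
    rw [hq.1]
    simp only [hq1, hq2, true_and]
    split_ifs <;> ring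

/-! ### Sums of `ρ_G` over the `D`-smooth numbers -/

/-- `∑_{s ≤ T, s D-smooth} ρ_G(s) ≤ (B (log₂ T + 1))^{ω(D)}` with `ρ_G(p^k) ≤ B`. [folklore] -/
theorem sum_smooth_rhoG_le {B : ℕ} (hB : ∀ p : ℕ, p.Prime → ∀ k : ℕ, rhoG a b c (p ^ k) ≤ B)
    (D T : ℕ) :
    ∑ s ∈ (Finset.Ioc 0 T).filter (fun s => s.primeFactors ⊆ D.primeFactors), (rhoG a b c s : ℝ) ≤
      ((B : ℝ) * (Nat.log 2 T + 1)) ^ D.primeFactors.card := by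
  have h := sum_smooth_le (fun n => (rhoG a b c n : ℝ)) (fun n => Nat.cast_nonneg _)
    (by rw [rhoG_one]; simp) (fun m n hmn => by exact_mod_cast rhoG_mul_of_coprime hmn) T D.primeFactors
    (fun p hp => Nat.prime_of_mem_primeFactors hp)
  refine h.trans ?_
  rw [← Finset.prod_const]
  refine Finset.prod_le_prod (fun p _ => Finset.sum_nonneg fun _ _ => Nat.cast_nonneg _) fun p hp => ?_
  have hp := Nat.prime_of_mem_primeFactors hp
  calc ∑ k ∈ Finset.range (Nat.log p T + 1), (rhoG a b c (p ^ k) : ℝ)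
      ≤ ∑ k ∈ Finset.range (Nat.log p T + 1), (B : ℝ) :=
        Finset.sum_le_sum fun k _ => by exact_mod_cast hB p hp k
    _ = (B : ℝ) * (Nat.log p T + 1) := by rw [Finset.sum_const, Finset.card_range, nsmul_eq_mul]; push_cast; ring
    _ ≤ (B : ℝ) * (Nat.log 2 T + 1) := by
        have : Nat.log p T ≤ Nat.log 2 T := Nat.log_anti_left (by norm_num) hp.two_le
        have : (Nat.log p T : ℝ) ≤ Nat.log 2 T := by exact_mod_cast this
        have hB0 : (0 : ℝ) ≤ B := Nat.cast_nonneg _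
        nlinarith

/-- `∑_{s ≤ T, s D-smooth} ρ_G(s)/s ≤ (2B)^{ω(D)}` with `ρ_G(p^k) ≤ B`. [folklore] -/
theorem sum_smooth_rhoG_div_le {B : ℕ} (hB : ∀ p : ℕ, p.Prime → ∀ k : ℕ, rhoG a b c (p ^ k) ≤ B)
    (D T : ℕ) :
    ∑ s ∈ (Finset.Ioc 0 T).filter (fun s => s.primeFactors ⊆ D.primeFactors), (rhoG a b c s : ℝ) / s ≤
      (2 * (B : ℝ)) ^ D.primeFactors.card := by
  have h := sum_smooth_le (fun n => (rhoG a b c n : ℝ) / n) (fun n => by positivity)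
    (by rw [rhoG_one]; simp) (fun m n hmn => by
      rw [rhoG_mul_of_coprime hmn]; push_cast
      rcases Nat.eq_zero_or_pos m with rfl | hm
      · simp
      rcases Nat.eq_zero_or_pos n with rfl | hn
      · simp
      field_simp) T D.primeFactors (fun p hp => Nat.prime_of_mem_primeFactors hp)
  refine h.trans ?_
  rw [← Finset.prod_const]
  refine Finset.prod_le_prod (fun p _ => Finset.sum_nonneg fun _ _ => by positivity) fun p hp => ?_
  have hp := Nat.prime_of_mem_primeFactors hp
  calc ∑ k ∈ Finset.range (Nat.log p T + 1), (rhoG a b c (p ^ k) : ℝ) / (p ^ k : ℕ)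
      ≤ ∑ k ∈ Finset.range (Nat.log p T + 1), (B : ℝ) * (1 / 2) ^ k := by
        refine Finset.sum_le_sum fun k _ => ?_
        have h1 : (rhoG a b c (p ^ k) : ℝ) ≤ B := by exact_mod_cast hB p hp k
        have h2 : ((1 : ℝ) / 2) ^ k ≥ 1 / (p ^ k : ℕ) := by
          push_cast
          rw [one_div_pow, ge_iff_le]
          apply one_div_le_one_div_of_le (by positivity)
          exact_mod_cast Nat.pow_le_pow_left hp.two_le k
        rw [div_eq_mul_one_div]
        exact mul_le_mul h1 h2 (by positivity) (Nat.cast_nonneg _)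
    _ = (B : ℝ) * ∑ k ∈ Finset.range (Nat.log p T + 1), (1 / 2 : ℝ) ^ k := by rw [Finset.mul_sum]
    _ ≤ (B : ℝ) * 2 := mul_le_mul_of_nonneg_left (sum_geometric_two_le _) (Nat.cast_nonneg _)
    _ = 2 * (B : ℝ) := mul_comm _ _

/-! ### The good part: the hyperbola method -/

/-- Integers prime to `Q₁ ⊇ {bad primes}` are prime to `D₀`. [folklore] -/
theorem coprime_badMod_of_coprime (ha : 0 < a) (hirr : Irreducible (quadPoly a b c)) {Q₁ g : ℕ}
    (hsub : (badMod a b c).primeFactors ⊆ Q₁.primeFactors) (hg : g.Coprime Q₁) :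
    g.Coprime (badMod a b c) := by
  have hD0 := badMod_ne_zero ha hirr
  rw [Nat.coprime_iff_gcd_eq_one]
  by_contra hne
  obtain ⟨p, hp, hpg⟩ := Nat.exists_prime_and_dvd hne
  have hp1 : p ∣ g := hpg.trans (Nat.gcd_dvd_left _ _)
  have hp2 : p ∣ badMod a b c := hpg.trans (Nat.gcd_dvd_right _ _)
  have hpQ : p ∈ Q₁.primeFactors := hsub (Nat.mem_primeFactors.2 ⟨hp, hp2, hD0⟩)
  have h1 : p ∣ Nat.gcd g Q₁ := Nat.dvd_gcd hp1 (Nat.mem_primeFactors.1 hpQ).2.1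
  rw [hg] at h1
  exact hp.one_lt.ne' (Nat.dvd_one.1 h1)

/-- The good inner sum `∑_{m ≤ W, (m, Q₁) = 1, m ≡ ν (d)} ρ_G(m)`. [folklore] -/
def goodSum (a b c : ℤ) (W Q₁ d ν : ℕ) : ℝ :=
  ∑ m ∈ (Finset.Ioc 0 W).filter (fun m => m.Coprime Q₁ ∧ m ≡ ν [MOD d]), (rhoG a b c m : ℝ)

/-- `Λ(E; R) = ∑_{e ≤ E, (e, R) = 1} μ²ψ_Δ(e)/e`. [folklore] -/
def psiSeries (Δ : ℤ) (R E : ℕ) : ℝ :=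
  ∑ e ∈ (Finset.Ioc 0 E).filter (fun e => e.Coprime R), sqfPsi Δ e / e

/-- `|Λ(E; R)| ≤ 1 + log E`. [folklore] -/
theorem abs_psiSeries_le (Δ : ℤ) (R E : ℕ) : |psiSeries Δ R E| ≤ 1 + Real.log E := by
  unfold psiSeries
  refine (Finset.abs_sum_le_sum_abs _ _).trans ?_
  calc ∑ e ∈ (Finset.Ioc 0 E).filter (fun e => e.Coprime R), |sqfPsi Δ e / e|
      ≤ ∑ e ∈ Finset.Ioc 0 E, |sqfPsi Δ e / e| :=
        Finset.sum_le_sum_of_subset_of_nonneg (Finset.filter_subset _ _) fun _ _ _ => abs_nonneg _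
    _ ≤ ∑ e ∈ Finset.Icc 1 E, (1 : ℝ) / e := by
        rw [show Finset.Ioc 0 E = Finset.Icc 1 E by ext; simp; omega]
        refine Finset.sum_le_sum fun e he => ?_
        rw [Finset.mem_Icc] at he
        rw [abs_div, abs_of_pos (by exact_mod_cast he.1 : (0 : ℝ) < e)]
        exact div_le_div_of_nonneg_right (abs_sqfPsi_le_one Δ e) (by positivity)
    _ ≤ 1 + Real.log E := by
        have h := harmonic_le_one_add_log E
        rw [harmonic_eq_sum_Icc, Rat.cast_sum] at h
        push_cast at h
        simpa only [one_div] using h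

/-- `Ioc 0 W = Icc 1 W`. [folklore] -/
theorem Ioc_zero_eq_Icc_one (W : ℕ) : Finset.Ioc 0 W = Finset.Icc 1 W := by
  ext; simp; omega

/-- `∑_{f ≤ F} 1/√f ≤ 2√F` in the form needed. [folklore] -/
theorem sum_Icc_sqrt_div_le (W F : ℕ) :
    ∑ f ∈ Finset.Icc 1 F, Real.sqrt ((W / f : ℕ) : ℝ) ≤ 2 * Real.sqrt W * Real.sqrt F := by
  calc ∑ f ∈ Finset.Icc 1 F, Real.sqrt ((W / f : ℕ) : ℝ) ≤ ∑ f ∈ Finset.Icc 1 F, Real.sqrt W * (1 / Real.sqrt f) := by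
        refine Finset.sum_le_sum fun f hf => ?_
        rw [Finset.mem_Icc] at hf
        have hf0 : (0 : ℝ) < f := by exact_mod_cast hf.1
        rw [mul_one_div, ← Real.sqrt_div (Nat.cast_nonneg W)]
        exact Real.sqrt_le_sqrt (Nat.cast_div_le)
    _ = Real.sqrt W * ∑ f ∈ Finset.Ioc 0 F, 1 / Real.sqrt f := by
        rw [Finset.mul_sum, Ioc_zero_eq_Icc_one]
    _ ≤ Real.sqrt W * (2 * Real.sqrt F) :=
        mul_le_mul_of_nonneg_left (sum_inv_sqrt_le F) (Real.sqrt_nonneg _)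
    _ = 2 * Real.sqrt W * Real.sqrt F := by ring

/-- **The good part of the mean value (hyperbola method).**  For `(Q₁, d) = 1`, `(d, 4Δ) = 1`,
`Q₁` divisible by every bad prime, `(ν, d) = 1` and `1 ≤ E ≤ W`:
`|∑_{m ≤ W, (m,Q₁)=1, m ≡ ν (d)} ρ_G(m) − (φ(Q₁)/Q₁)(W/d) Λ(E; Q₁d)| ≤ (τ(Q₁) + 1) E + 2M W/√E`,
`M = 2N τ(Q₁)`, `N = 4|Δ|` (`ρ_G = 1 ⋆ μ²ψ_Δ` on these `m`; `e ≤ E`: residue-class counting;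
`e > E`: character sums over `e` for each `f ≤ W/E`). [folklore] -/
theorem abs_goodSum_sub_le (ha : 0 < a) (hc : Odd c) (hirr : Irreducible (quadPoly a b c))
    {Q₁ d ν W E : ℕ} (hQ₁ : Q₁ ≠ 0) (hd0 : 0 < d) (hQ₁d : Q₁.Coprime d)
    (hd : d.Coprime (4 * (b ^ 2 - 4 * a * c).natAbs))
    (hsub : (badMod a b c).primeFactors ⊆ Q₁.primeFactors) (hν : ν.Coprime d) (hE : 1 ≤ E) (hEW : E ≤ W) :
    |goodSum a b c W Q₁ d ν - (Nat.totient Q₁ : ℝ) / Q₁ * (W / d) * psiSeries (b ^ 2 - 4 * a * c) (Q₁ * d) E| ≤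
      (Q₁.divisors.card + 1) * E +
        2 * (2 * (4 * (b ^ 2 - 4 * a * c).natAbs) * Q₁.divisors.card) * W / Real.sqrt E := by
  classical
  set Δ := b ^ 2 - 4 * a * c with hΔ
  set τ : ℝ := (Q₁.divisors.card : ℝ) with hτ
  set M : ℝ := 2 * (4 * (Δ.natAbs : ℝ)) * Q₁.divisors.card with hM
  set φQ : ℝ := (Nat.totient Q₁ : ℝ) / Q₁ with hφQ
  have hτ0 : 0 ≤ τ := Nat.cast_nonneg _
  have hM0 : 0 ≤ M := by positivity
  have hφQ0 : 0 ≤ φQ := by positivity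
  have hφQ1 : φQ ≤ 1 := by
    rw [hφQ, div_le_one (by exact_mod_cast Nat.pos_of_ne_zero hQ₁)]
    exact_mod_cast Nat.totient_le Q₁
  have hE0 : (0 : ℝ) < E := by exact_mod_cast hE
  have hW0 : (0 : ℝ) < W := by exact_mod_cast (lt_of_lt_of_le hE hEW)
  -- the weight
  set cw : ℕ → ℝ := fun m => if m.Coprime Q₁ ∧ m ≡ ν [MOD d] then 1 else 0 with hcw
  have hcw01 : ∀ m, cw m = 0 ∨ cw m = 1 := fun m => by simp only [hcw]; split_ifs <;> simp
  -- Step 1: `goodSum = ∑_{e ≤ W} μ²ψ(e) ∑_{f ≤ W/e} cw(ef)`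
  have h1 : goodSum a b c W Q₁ d ν =
      ∑ e ∈ Finset.Icc 1 W, sqfPsi Δ e * ∑ f ∈ Finset.Icc 1 (W / e), cw (e * f) := by
    unfold goodSum
    rw [Finset.sum_filter, Ioc_zero_eq_Icc_one]
    have hstep : ∀ m ∈ Finset.Icc 1 W, (if m.Coprime Q₁ ∧ m ≡ ν [MOD d] then (rhoG a b c m : ℝ) else 0) =
        ∑ q ∈ m.divisorsAntidiagonal, sqfPsi Δ q.1 * cw (q.1 * q.2) := by
      intro m hm
      rw [Finset.mem_Icc] at hm
      have hq : ∀ q ∈ m.divisorsAntidiagonal, sqfPsi Δ q.1 * cw (q.1 * q.2) = sqfPsi Δ q.1 * cw m := by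
        intro q hq; rw [(Nat.mem_divisorsAntidiagonal.1 hq).1]
      rw [Finset.sum_congr rfl hq, ← Finset.sum_mul]
      by_cases hcond : m.Coprime Q₁ ∧ m ≡ ν [MOD d]
      · rw [if_pos hcond, show cw m = 1 by simp only [hcw, if_pos hcond], mul_one,
          rhoG_eq_sum_divisors_sqfPsi ha hirr (by omega) (coprime_badMod_of_coprime ha hirr hsub hcond.1),
          Nat.sum_divisorsAntidiagonal (fun e _ => sqfPsi Δ e)]
      · rw [if_neg hcond, show cw m = 0 by simp only [hcw, if_neg hcond], mul_zero]
    rw [Finset.sum_congr rfl hstep, SquarefreeSums.sum_Icc_sum_divisorsAntidiagonal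
      (fun e f => sqfPsi Δ e * cw (e * f)) W]
    simp only [Finset.mul_sum]
  -- Step 2: split at `E`
  have hIcc : Finset.Icc 1 W = Finset.Icc 1 E ∪ Finset.Ioc E W := by
    rw [← Ioc_zero_eq_Icc_one, ← Ioc_zero_eq_Icc_one, Finset.Ioc_union_Ioc_eq_Ioc (Nat.zero_le E) hEW]
  have hdisjE : Disjoint (Finset.Icc 1 E) (Finset.Ioc E W) := by
    rw [← Ioc_zero_eq_Icc_one]; exact Finset.Ioc_disjoint_Ioc_of_le le_rfl
  rw [h1, hIcc, Finset.sum_union hdisjE]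
  set A := ∑ e ∈ Finset.Icc 1 E, sqfPsi Δ e * ∑ f ∈ Finset.Icc 1 (W / e), cw (e * f) with hA
  set Bs := ∑ e ∈ Finset.Ioc E W, sqfPsi Δ e * ∑ f ∈ Finset.Icc 1 (W / e), cw (e * f) with hBs
  -- Step 3: part A
  have hpartA : |A - φQ * (W / d) * psiSeries Δ (Q₁ * d) E| ≤ (τ + 1) * E := by
    have hmain : φQ * (W / d) * psiSeries Δ (Q₁ * d) E =
        ∑ e ∈ Finset.Icc 1 E, (if e.Coprime (Q₁ * d) then sqfPsi Δ e / e * (φQ * (W / d)) else 0) := by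
      unfold psiSeries
      rw [Finset.sum_filter, Ioc_zero_eq_Icc_one, Finset.mul_sum]
      refine Finset.sum_congr rfl fun e _ => ?_
      split_ifs <;> ring
    rw [hmain, hA, ← Finset.sum_sub_distrib]
    refine (Finset.abs_sum_le_sum_abs _ _).trans ?_
    have hterm : ∀ e ∈ Finset.Icc 1 E, |sqfPsi Δ e * ∑ f ∈ Finset.Icc 1 (W / e), cw (e * f) -
        (if e.Coprime (Q₁ * d) then sqfPsi Δ e / e * (φQ * (W / d)) else 0)| ≤ τ + 1 := by
      intro e he
      rw [Finset.mem_Icc] at he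
      have he0 : 0 < e := he.1
      have he0' : (0 : ℝ) < e := by exact_mod_cast he0
      by_cases hcop : e.Coprime (Q₁ * d)
      · rw [if_pos hcop]
        have heQ : e.Coprime Q₁ := Nat.Coprime.coprime_dvd_right (dvd_mul_right _ _) hcop
        have hed : e.Coprime d := Nat.Coprime.coprime_dvd_right (dvd_mul_left _ _) hcop
        obtain ⟨ν', hν'⟩ := exists_mul_modEq_iff hd0 hed ν
        -- the inner count is `copCount (W/e) Q₁ d ν'`
        have hinner : ∑ f ∈ Finset.Icc 1 (W / e), cw (e * f) = (copCount (W / e) Q₁ d ν' : ℝ) := by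
          unfold copCount
          rw [Finset.card_eq_sum_ones, Nat.cast_sum, Finset.sum_filter, Ioc_zero_eq_Icc_one]
          push_cast
          refine Finset.sum_congr rfl fun f _ => ?_
          simp only [hcw]
          have hiff : ((e * f).Coprime Q₁ ∧ e * f ≡ ν [MOD d]) ↔ (f.Coprime Q₁ ∧ f ≡ ν' [MOD d]) := by
            rw [Nat.coprime_mul_iff_left, mul_comm, hν' f]
            exact ⟨fun h => ⟨h.1.2, h.2⟩, fun h => ⟨⟨heQ, h.1⟩, h.2⟩⟩
          simp only [hiff]
        rw [hinner]
        have hc := abs_copCount_sub_le (W := W / e) (ν := ν') hQ₁ hd0 hQ₁d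
        have hfl : |φQ * ((W / e : ℕ) : ℝ) / d - φQ * ((W : ℝ) / e) / d| ≤ 1 := by
          rw [← sub_div, ← mul_sub, abs_div, abs_mul, abs_of_nonneg hφQ0,
            abs_of_pos (by exact_mod_cast hd0 : (0 : ℝ) < d)]
          have h1 : |((W / e : ℕ) : ℝ) - (W : ℝ) / e| ≤ 1 := by
            rw [abs_sub_comm, abs_le]
            constructor
            · linarith [Nat.cast_div_le (m := W) (n := e) (α := ℝ)]
            · have := Nat.lt_div_mul_add (a := W) he0
              have h' : (W : ℝ) < (W / e : ℕ) * e + e := by exact_mod_cast this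
              rw [div_sub' (hc := he0'.ne'), div_le_one he0']
              linarith
          have hd1 : (1 : ℝ) ≤ d := by exact_mod_cast hd0
          calc φQ * |((W / e : ℕ) : ℝ) - (W : ℝ) / e| / d ≤ 1 * 1 / 1 := by
                gcongr
            _ = 1 := by norm_num
        have hψ := abs_sqfPsi_le_one Δ e
        -- combine
        have e1 : sqfPsi Δ e * (copCount (W / e) Q₁ d ν' : ℝ) - sqfPsi Δ e / e * (φQ * (W / d)) =
            sqfPsi Δ e * ((copCount (W / e) Q₁ d ν' : ℝ) - φQ * ((W / e : ℕ) : ℝ) / d) +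
              sqfPsi Δ e * (φQ * ((W / e : ℕ) : ℝ) / d - φQ * ((W : ℝ) / e) / d) := by
          field_simp; ring
        rw [e1]
        have hc' : |(copCount (W / e) Q₁ d ν' : ℝ) - φQ * ((W / e : ℕ) : ℝ) / d| ≤ τ := by
          have : φQ * ((W / e : ℕ) : ℝ) / d = (Nat.totient Q₁ : ℝ) / Q₁ * ((W / e : ℕ) : ℝ) / d := by
            rw [hφQ]
          rw [this]; exact hc
        calc |sqfPsi Δ e * ((copCount (W / e) Q₁ d ν' : ℝ) - φQ * ((W / e : ℕ) : ℝ) / d) +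
              sqfPsi Δ e * (φQ * ((W / e : ℕ) : ℝ) / d - φQ * ((W : ℝ) / e) / d)|
            ≤ |sqfPsi Δ e| * |(copCount (W / e) Q₁ d ν' : ℝ) - φQ * ((W / e : ℕ) : ℝ) / d| +
              |sqfPsi Δ e| * |φQ * ((W / e : ℕ) : ℝ) / d - φQ * ((W : ℝ) / e) / d| := by
              rw [← abs_mul, ← abs_mul]; exact abs_add_le _ _
          _ ≤ 1 * τ + 1 * 1 := add_le_add (mul_le_mul hψ hc' (abs_nonneg _) zero_le_one)
              (mul_le_mul hψ hfl (abs_nonneg _) zero_le_one)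
          _ = τ + 1 := by ring
      · -- `e` not prime to `Q₁ d`: every `cw (e f)` vanishes
        rw [if_neg hcop, sub_zero]
        have hz : ∀ f ∈ Finset.Icc 1 (W / e), cw (e * f) = 0 := by
          intro f _
          simp only [hcw]
          rw [if_neg]
          rintro ⟨h1, h2⟩
          apply hcop
          have heQ : e.Coprime Q₁ := Nat.Coprime.coprime_dvd_left (dvd_mul_right e f) h1
          have hefd : (e * f).Coprime d := by
            rw [Nat.coprime_iff_gcd_eq_one, Nat.ModEq.gcd_eq h2]; exact hν
          have hed : e.Coprime d := Nat.Coprime.coprime_dvd_left (dvd_mul_right e f) hefd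
          exact Nat.Coprime.mul_right heQ hed
        rw [Finset.sum_eq_zero hz, mul_zero, abs_zero]
        positivity
    calc ∑ e ∈ Finset.Icc 1 E, |sqfPsi Δ e * ∑ f ∈ Finset.Icc 1 (W / e), cw (e * f) -
          (if e.Coprime (Q₁ * d) then sqfPsi Δ e / e * (φQ * (W / d)) else 0)|
        ≤ ∑ e ∈ Finset.Icc 1 E, (τ + 1) := Finset.sum_le_sum hterm
      _ = (τ + 1) * E := by rw [Finset.sum_const, Nat.card_Icc, nsmul_eq_mul]; push_cast; ring
  -- Step 4: part B
  have hpartB : |Bs| ≤ 2 * M * W / Real.sqrt E := by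
    -- as a double sum over `f` first
    set F : ℕ → ℕ → ℝ := fun e f => (if E < e then sqfPsi Δ e else 0) * cw (e * f) with hF
    have hfilt : ∀ X : ℕ, (Finset.Icc 1 X).filter (fun e => E < e) = Finset.Ioc E X := by
      intro X; ext e; simp only [Finset.mem_filter, Finset.mem_Icc, Finset.mem_Ioc]; omega
    have hBs' : Bs = ∑ f ∈ Finset.Icc 1 W, ∑ e ∈ Finset.Icc 1 (W / f), F e f := by
      rw [← sum_Icc_div_comm W F, hBs, ← hfilt W, Finset.sum_filter]
      refine Finset.sum_congr rfl fun e _ => ?_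
      simp only [hF]
      split_ifs with h
      · rw [Finset.mul_sum]
      · simp
    -- the inner sums
    have hinner : ∀ f ∈ Finset.Icc 1 W, |∑ e ∈ Finset.Icc 1 (W / f), F e f| ≤
        (if f ≤ W / E then Real.sqrt ((W / f : ℕ) : ℝ) * M else 0) := by
      intro f hf
      rw [Finset.mem_Icc] at hf
      have hf0 : 0 < f := hf.1
      have hI : ∑ e ∈ Finset.Icc 1 (W / f), F e f = ∑ e ∈ Finset.Ioc E (W / f), sqfPsi Δ e * cw (e * f) := by
        rw [← hfilt (W / f), Finset.sum_filter]
        refine Finset.sum_congr rfl fun e _ => ?_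
        simp only [hF]; split_ifs <;> simp
      rw [hI]
      split_ifs with hfE
      · by_cases hcop : f.Coprime (Q₁ * d)
        · have hfQ : f.Coprime Q₁ := Nat.Coprime.coprime_dvd_right (dvd_mul_right _ _) hcop
          have hfd : f.Coprime d := Nat.Coprime.coprime_dvd_right (dvd_mul_left _ _) hcop
          obtain ⟨ν', hν'⟩ := exists_mul_modEq_iff hd0 hfd ν
          have hν'd : ν'.Coprime d := by
            have h1 : ν' * f ≡ ν [MOD d] := (hν' ν').2 (Nat.ModEq.refl _)
            have h2 : (ν' * f).Coprime d := by
              rw [Nat.coprime_iff_gcd_eq_one, Nat.ModEq.gcd_eq h1]; exact hν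
            exact Nat.Coprime.coprime_dvd_left (dvd_mul_right _ _) h2
          have hre : ∑ e ∈ Finset.Ioc E (W / f), sqfPsi Δ e * cw (e * f) =
              ∑ e ∈ (Finset.Ioc E (W / f)).filter
                (fun e => Squarefree e ∧ e.Coprime Q₁ ∧ e ≡ ν' [MOD d]), jacPsi Δ e := by
            rw [Finset.sum_filter]
            refine Finset.sum_congr rfl fun e _ => ?_
            simp only [hcw, sqfPsi_apply]
            have hiff : ((e * f).Coprime Q₁ ∧ e * f ≡ ν [MOD d]) ↔ (e.Coprime Q₁ ∧ e ≡ ν' [MOD d]) := by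
              rw [Nat.coprime_mul_iff_left, hν' e]
              exact ⟨fun h => ⟨h.1.1, h.2⟩, fun h => ⟨⟨h.1, hfQ⟩, h.2⟩⟩
            simp only [hiff]
            by_cases h1 : Squarefree e <;> by_cases h2 : (e.Coprime Q₁ ∧ e ≡ ν' [MOD d]) <;> simp [h1, h2]
          rw [hre]
          have hb := abs_sum_jacPsi_sqf_coprime_modEq_le ha hc hirr hQ₁ hd0 hQ₁d hd hsub hν'd E (W / f)
          refine hb.trans ?_
          rw [← hM]
          have hs : ((Nat.sqrt (W / f) : ℕ) : ℝ) ≤ Real.sqrt ((W / f : ℕ) : ℝ) := Real.nat_sqrt_le_real_sqrt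
          exact mul_le_mul_of_nonneg_right hs hM0
        · -- `f` not prime to `Q₁ d`: all weights vanish
          rw [Finset.sum_eq_zero]
          · rw [abs_zero]; positivity
          intro e _
          simp only [hcw]
          rw [if_neg, mul_zero]
          rintro ⟨h1, h2⟩
          apply hcop
          have hfQ : f.Coprime Q₁ := Nat.Coprime.coprime_dvd_left (dvd_mul_left f e) h1
          have hefd : (e * f).Coprime d := by
            rw [Nat.coprime_iff_gcd_eq_one, Nat.ModEq.gcd_eq h2]; exact hν
          have hfd : f.Coprime d := Nat.Coprime.coprime_dvd_left (dvd_mul_left f e) hefd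
          exact Nat.Coprime.mul_right hfQ hfd
      · -- `f > W/E`: the range is empty
        have hlt : W / f < E + 1 := by
          push Not at hfE
          have h1 : W < f * E := by
            have := Nat.lt_of_div_lt_div (c := E) (by rwa [Nat.mul_div_cancel _ (by omega : 0 < E)] : W / E < f * E / E)
            exact this
          have : W / f < E := by
            rw [Nat.div_lt_iff_lt_mul hf0]; rw [mul_comm] at h1; exact h1
          omega
        rw [Finset.Ioc_eq_empty (by omega), Finset.sum_empty, abs_zero]
    rw [hBs']
    refine (Finset.abs_sum_le_sum_abs _ _).trans ?_
    refine (Finset.sum_le_sum hinner).trans ?_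
    rw [← Finset.sum_filter]
    have hfil : (Finset.Icc 1 W).filter (fun f => f ≤ W / E) = Finset.Icc 1 (W / E) := by
      ext f; simp only [Finset.mem_filter, Finset.mem_Icc]
      constructor
      · rintro ⟨⟨h1, -⟩, h2⟩; exact ⟨h1, h2⟩
      · rintro ⟨h1, h2⟩; exact ⟨⟨h1, h2.trans (Nat.div_le_self W E)⟩, h2⟩
    rw [hfil, ← Finset.sum_mul]
    have hsum := sum_Icc_sqrt_div_le W (W / E)
    have hWE : Real.sqrt ((W / E : ℕ) : ℝ) ≤ Real.sqrt W / Real.sqrt E := by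
      rw [← Real.sqrt_div (Nat.cast_nonneg W)]
      exact Real.sqrt_le_sqrt Nat.cast_div_le
    have hsW : Real.sqrt W * Real.sqrt W = W := Real.mul_self_sqrt (Nat.cast_nonneg W)
    have hsE : 0 < Real.sqrt E := Real.sqrt_pos.2 hE0
    calc (∑ f ∈ Finset.Icc 1 (W / E), Real.sqrt ((W / f : ℕ) : ℝ)) * M
        ≤ (2 * Real.sqrt W * Real.sqrt ((W / E : ℕ) : ℝ)) * M := mul_le_mul_of_nonneg_right hsum hM0
      _ ≤ (2 * Real.sqrt W * (Real.sqrt W / Real.sqrt E)) * M := by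
          refine mul_le_mul_of_nonneg_right ?_ hM0
          exact mul_le_mul_of_nonneg_left hWE (by positivity)
      _ = 2 * M * W / Real.sqrt E := by
          field_simp
          rw [sq, hsW]; ring
  -- Step 5: combine
  have hM' : (2 * (2 * (4 * ((b ^ 2 - 4 * a * c).natAbs : ℝ)) * Q₁.divisors.card) * W / Real.sqrt E) =
      2 * M * W / Real.sqrt E := by rw [hM]
  rw [hM']
  calc |A + Bs - φQ * (W / d) * psiSeries Δ (Q₁ * d) E|
      = |(A - φQ * (W / d) * psiSeries Δ (Q₁ * d) E) + Bs| := by ring_nf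
    _ ≤ |A - φQ * (W / d) * psiSeries Δ (Q₁ * d) E| + |Bs| := abs_add_le _ _
    _ ≤ (τ + 1) * E + 2 * M * W / Real.sqrt E := add_le_add hpartA hpartB

/-! ### The mean value of `ρ_G` with coprimality and congruence conditions -/

/-- `Σ₀(Y; Q, d, μ) = ∑_{m ≤ Y, (m, Q) = 1, m ≡ μ (mod d)} ρ_G(m)` (Iwaniec p. 179 for `𝒜_G`).
[cite: IwaniecInventiones1978, §4 proof of Lemma 4] -/
def rhoSumAPG (a b c : ℤ) (Y Q d μ : ℕ) : ℕ :=
  ∑ m ∈ (Finset.Ioc 0 Y).filter (fun m => m.Coprime Q ∧ m ≡ μ [MOD d]), rhoG a b c m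

/-- The bad-part factor `S(T; Q) = ∑_{s ≤ T, s D₀-smooth, (s, Q) = 1} ρ_G(s)/s`. [folklore] -/
def smoothRhoSeries (a b c : ℤ) (Q T : ℕ) : ℝ :=
  ∑ s ∈ (Finset.Ioc 0 T).filter (fun s => s.primeFactors ⊆ (badMod a b c).primeFactors ∧ s.Coprime Q),
    (rhoG a b c s : ℝ) / s

/-- **The density `κ_G(Q; E, T)`** of `ρ_G` on the integers prime to `Q` (up to the factor `1/φ(d)`
for the class condition): `κ_G = (φ(D₀Q)/(D₀Q)) · Λ(E; D₀Q) · S(T; Q)` — independent of the class `μ`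
and of `d` (the one feature the dispersion identity uses). [cite: IwaniecInventiones1978, §4 p. 179] -/
def kappaG (a b c : ℤ) (Q E T : ℕ) : ℝ :=
  (Nat.totient (badMod a b c * Q) : ℝ) / (badMod a b c * Q) *
    psiSeries (b ^ 2 - 4 * a * c) (badMod a b c * Q) E * smoothRhoSeries a b c Q T

/-- `0 ≤ S(T; Q) ≤ (2B_G)^{ω(D₀)}`. [folklore] -/
theorem smoothRhoSeries_nonneg (Q T : ℕ) : 0 ≤ smoothRhoSeries a b c Q T :=
  Finset.sum_nonneg fun _ _ => by positivity

/-- `S(T; Q) ≤ (2B_G)^{ω(D₀)}`. [folklore] -/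
theorem smoothRhoSeries_le {B : ℕ} (hB : ∀ p : ℕ, p.Prime → ∀ k : ℕ, rhoG a b c (p ^ k) ≤ B) (Q T : ℕ) :
    smoothRhoSeries a b c Q T ≤ (2 * (B : ℝ)) ^ (badMod a b c).primeFactors.card := by
  refine le_trans ?_ (sum_smooth_rhoG_div_le hB (badMod a b c) T)
  unfold smoothRhoSeries
  refine Finset.sum_le_sum_of_subset_of_nonneg ?_ fun _ _ _ => by positivity
  exact Finset.monotone_filter_right _ fun s _ h => h.1

/-- `|κ_G(Q; E, T)| ≤ (1 + log E) (2B_G)^{ω(D₀)}`. [folklore] -/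
theorem abs_kappaG_le {B : ℕ} (hB : ∀ p : ℕ, p.Prime → ∀ k : ℕ, rhoG a b c (p ^ k) ≤ B) (Q E T : ℕ) :
    |kappaG a b c Q E T| ≤ (1 + Real.log E) * (2 * (B : ℝ)) ^ (badMod a b c).primeFactors.card := by
  unfold kappaG
  rw [abs_mul, abs_mul]
  have h1 : |(Nat.totient (badMod a b c * Q) : ℝ) / (badMod a b c * Q)| ≤ 1 := by
    rw [abs_of_nonneg (by positivity)]
    rcases Nat.eq_zero_or_pos (badMod a b c * Q) with h0 | h0
    · rw [h0]; simp
    · rw [div_le_one (by exact_mod_cast h0)]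
      exact_mod_cast Nat.totient_le _
  have h2 := abs_psiSeries_le (b ^ 2 - 4 * a * c) (badMod a b c * Q) E
  have h3 : |smoothRhoSeries a b c Q T| ≤ (2 * (B : ℝ)) ^ (badMod a b c).primeFactors.card := by
    rw [abs_of_nonneg (smoothRhoSeries_nonneg Q T)]; exact smoothRhoSeries_le hB Q T
  have hlog : 0 ≤ 1 + Real.log E := by
    rcases Nat.eq_zero_or_pos E with rfl | hE
    · simp
    · have := Real.log_nonneg (by exact_mod_cast hE : (1 : ℝ) ≤ E); linarith
  calc |(Nat.totient (badMod a b c * Q) : ℝ) / (badMod a b c * Q)| * |psiSeries (b ^ 2 - 4 * a * c) (badMod a b c * Q) E| *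
        |smoothRhoSeries a b c Q T| ≤ 1 * (1 + Real.log E) * (2 * (B : ℝ)) ^ (badMod a b c).primeFactors.card := by
        refine mul_le_mul (mul_le_mul h1 h2 (abs_nonneg _) zero_le_one) h3 (abs_nonneg _) ?_
        positivity
    _ = _ := by ring

/-- A `D`-smooth number is prime to anything prime to `D`. [folklore] -/
theorem coprime_of_primeFactors_subset {s D d : ℕ} (hs : s ≠ 0) (hsub : s.primeFactors ⊆ D.primeFactors)
    (hDd : D.Coprime d) : s.Coprime d := by
  rw [Nat.coprime_iff_gcd_eq_one]
  by_contra hne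
  obtain ⟨p, hp, hpg⟩ := Nat.exists_prime_and_dvd hne
  have hps : p ∣ s := hpg.trans (Nat.gcd_dvd_left _ _)
  have hpd : p ∣ d := hpg.trans (Nat.gcd_dvd_right _ _)
  have hpD : p ∣ D := (Nat.mem_primeFactors.1 (hsub (Nat.mem_primeFactors.2 ⟨hp, hps, hs⟩))).2.1
  have : p ∣ Nat.gcd D d := Nat.dvd_gcd hpD hpd
  rw [hDd] at this
  exact hp.one_lt.ne' (Nat.dvd_one.1 this)

/-- `log Y ≤ log₂ Y + 1` (natural logarithm against the integer binary logarithm). [folklore] -/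
theorem log_le_natLog_add_one (Y : ℕ) : Real.log Y ≤ Nat.log 2 Y + 1 := by
  rcases Nat.eq_zero_or_pos Y with rfl | hY
  · simp
  have h1 : Y < 2 ^ (Nat.log 2 Y + 1) := Nat.lt_pow_succ_log_self (by norm_num) Y
  have h2 : (Y : ℝ) < (2 : ℝ) ^ (Nat.log 2 Y + 1) := by exact_mod_cast h1
  have h3 : Real.log Y < (Nat.log 2 Y + 1 : ℕ) * Real.log 2 := by
    rw [← Real.log_pow]
    exact Real.log_lt_log (by exact_mod_cast hY) h2
  have h4 : Real.log 2 ≤ 1 := by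
    have := Real.log_two_lt_d9; linarith
  have h5 : ((Nat.log 2 Y + 1 : ℕ) : ℝ) * Real.log 2 ≤ (Nat.log 2 Y + 1 : ℕ) := by
    have h0 : (0 : ℝ) ≤ (Nat.log 2 Y + 1 : ℕ) := Nat.cast_nonneg _
    nlinarith
  push_cast at h3 h5
  linarith

/-- The weight of the smooth variable: `g(s) = [s D₀-smooth, (s, Q) = 1] ρ_G(s)`. [folklore] -/
def smoothCopWeight (a b c : ℤ) (Q s : ℕ) : ℝ :=
  if s.primeFactors ⊆ (badMod a b c).primeFactors ∧ s.Coprime Q then (rhoG a b c s : ℝ) else 0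

/-- `0 ≤ g(s)`. [folklore] -/
theorem smoothCopWeight_nonneg (Q s : ℕ) : 0 ≤ smoothCopWeight a b c Q s := by
  unfold smoothCopWeight; split_ifs <;> positivity

/-- `g(s) ≤ [s smooth] ρ_G(s)`. [folklore] -/
theorem smoothCopWeight_le (Q s : ℕ) :
    smoothCopWeight a b c Q s ≤ (if s.primeFactors ⊆ (badMod a b c).primeFactors then (rhoG a b c s : ℝ) else 0) := by
  unfold smoothCopWeight
  by_cases h1 : s.primeFactors ⊆ (badMod a b c).primeFactors
  · by_cases h2 : s.Coprime Q
    · rw [if_pos ⟨h1, h2⟩, if_pos h1]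
    · rw [if_neg (fun h => h2 h.2), if_pos h1]; positivity
  · rw [if_neg (fun h => h1 h.1), if_neg h1]

/-- `g(s) = 0` for `s` not smooth. [folklore] -/
theorem smoothCopWeight_eq_zero {Q s : ℕ} (h : ¬ s.primeFactors ⊆ (badMod a b c).primeFactors) :
    smoothCopWeight a b c Q s = 0 := by
  unfold smoothCopWeight; rw [if_neg (fun h' => h h'.1)]

/-- `∑_{s ≤ X} g(s) ≤ (B (log₂ X + 1))^{ω(D₀)}` and `∑_{s ≤ X} g(s)/s ≤ (2B)^{ω(D₀)}`. [folklore] -/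
theorem sum_smoothCopWeight_le {B : ℕ} (hB : ∀ p : ℕ, p.Prime → ∀ k : ℕ, rhoG a b c (p ^ k) ≤ B) (Q X : ℕ) :
    ∑ s ∈ Finset.Icc 1 X, smoothCopWeight a b c Q s ≤ ((B : ℝ) * (Nat.log 2 X + 1)) ^ (badMod a b c).primeFactors.card := by
  refine le_trans ?_ (sum_smooth_rhoG_le hB (badMod a b c) X)
  rw [Finset.sum_filter, Ioc_zero_eq_Icc_one]
  exact Finset.sum_le_sum fun s _ => smoothCopWeight_le Q s

/-- `∑_{s ≤ X} g(s)/s ≤ (2B)^{ω(D₀)}`. [folklore] -/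
theorem sum_smoothCopWeight_div_le {B : ℕ} (hB : ∀ p : ℕ, p.Prime → ∀ k : ℕ, rhoG a b c (p ^ k) ≤ B) (Q X : ℕ) :
    ∑ s ∈ Finset.Icc 1 X, smoothCopWeight a b c Q s / s ≤ (2 * (B : ℝ)) ^ (badMod a b c).primeFactors.card := by
  refine le_trans ?_ (sum_smooth_rhoG_div_le hB (badMod a b c) X)
  rw [Finset.sum_filter, Ioc_zero_eq_Icc_one]
  refine Finset.sum_le_sum fun s _ => ?_
  have := smoothCopWeight_le (a := a) (b := b) (c := c) Q s
  split_ifs with h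
  · rw [if_pos h] at this; exact div_le_div_of_nonneg_right this (Nat.cast_nonneg _)
  · rw [smoothCopWeight_eq_zero h, zero_div]

/-- `S(T; Q) = ∑_{s ≤ T} g(s)/s`. [folklore] -/
theorem smoothRhoSeries_eq (Q T : ℕ) :
    smoothRhoSeries a b c Q T = ∑ s ∈ Finset.Icc 1 T, smoothCopWeight a b c Q s / s := by
  unfold smoothRhoSeries smoothCopWeight
  rw [Finset.sum_filter, Ioc_zero_eq_Icc_one]
  refine Finset.sum_congr rfl fun s _ => ?_
  split_ifs <;> simp

section MeanValue

variable (ha : 0 < a) (hc : Odd c) (hirr : Irreducible (quadPoly a b c))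
include ha hirr

/-- **Step 1 of the mean value: the bad/good splitting of `Σ₀`.**  For `Q` squarefree, `d ∣ Q`,
`(d, D₀) = 1`, `(μ, d) = 1`:
`Σ₀(Y; Q, d, μ) = ∑_{s ≤ Y} g(s) · goodSum(Y/s; D₀·(Q/d), d, μ s̄)`. [folklore] -/
theorem rhoSumAPG_eq_sum_smoothCopWeight {Q d μ Y : ℕ} (hQ : Squarefree Q) (hdQ : d ∣ Q)
    (hdD : d.Coprime (badMod a b c)) (hμ : μ.Coprime d) :
    ∃ μf : ℕ → ℕ, (∀ s ∈ Finset.Icc 1 Y, s.primeFactors ⊆ (badMod a b c).primeFactors → (μf s).Coprime d) ∧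
      (rhoSumAPG a b c Y Q d μ : ℝ) =
        ∑ s ∈ Finset.Icc 1 Y, smoothCopWeight a b c Q s * goodSum a b c (Y / s) (badMod a b c * (Q / d)) d (μf s) := by
  classical
  set D := badMod a b c with hD
  have hD0 : D ≠ 0 := badMod_ne_zero ha hirr
  have hQ0 : Q ≠ 0 := hQ.ne_zero
  have hd0 : 0 < d := Nat.pos_of_dvd_of_pos hdQ (Nat.pos_of_ne_zero hQ0)
  set q' := Q / d with hq'
  have hQeq : q' * d = Q := Nat.div_mul_cancel hdQ
  set Q₁ := D * q' with hQ₁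
  -- the weight and the splitting
  set w : ℕ → ℝ := fun m => if m.Coprime Q ∧ m ≡ μ [MOD d] then 1 else 0 with hw
  have hsplit : (rhoSumAPG a b c Y Q d μ : ℝ) =
      ∑ s ∈ Finset.Icc 1 Y, (if s.primeFactors ⊆ D.primeFactors then (rhoG a b c s : ℝ) else 0) *
        ∑ t ∈ Finset.Icc 1 (Y / s), (if t.Coprime D then (rhoG a b c t : ℝ) else 0) * w (s * t) := by
    rw [← sum_rhoG_mul_eq_sum_smooth_sum_good hD0 Y w]
    unfold rhoSumAPG
    rw [Nat.cast_sum, Finset.sum_filter, Ioc_zero_eq_Icc_one]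
    refine Finset.sum_congr rfl fun m _ => ?_
    simp only [hw]; split_ifs <;> simp
  have hinner : ∀ s ∈ Finset.Icc 1 Y, s.primeFactors ⊆ D.primeFactors →
      ∃ μ' : ℕ, μ'.Coprime d ∧
        ∑ t ∈ Finset.Icc 1 (Y / s), (if t.Coprime D then (rhoG a b c t : ℝ) else 0) * w (s * t) =
          (if s.Coprime Q then goodSum a b c (Y / s) Q₁ d μ' else 0) := by
    intro s hs hsm
    rw [Finset.mem_Icc] at hs
    have hs0 : s ≠ 0 := by omega
    have hsd : s.Coprime d := coprime_of_primeFactors_subset hs0 hsm hdD.symm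
    obtain ⟨μ', hμ'⟩ := exists_mul_modEq_iff hd0 hsd μ
    have hμ'd : μ'.Coprime d := by
      have h1 : μ' * s ≡ μ [MOD d] := (hμ' μ').2 (Nat.ModEq.refl _)
      have h2 : (μ' * s).Coprime d := by rw [Nat.coprime_iff_gcd_eq_one, Nat.ModEq.gcd_eq h1]; exact hμ
      exact Nat.Coprime.coprime_dvd_left (dvd_mul_right _ _) h2
    refine ⟨μ', hμ'd, ?_⟩
    by_cases hsQ : s.Coprime Q
    · rw [if_pos hsQ]
      unfold goodSum
      rw [Finset.sum_filter, Ioc_zero_eq_Icc_one]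
      refine Finset.sum_congr rfl fun t _ => ?_
      simp only [hw]
      have hiff : (t.Coprime D ∧ ((s * t).Coprime Q ∧ s * t ≡ μ [MOD d])) ↔ (t.Coprime Q₁ ∧ t ≡ μ' [MOD d]) := by
        constructor
        · rintro ⟨htD, hstQ, hst⟩
          have htQ : t.Coprime Q := Nat.Coprime.coprime_dvd_left (dvd_mul_left t s) hstQ
          refine ⟨Nat.Coprime.mul_right htD (htQ.coprime_dvd_right (Dvd.intro _ hQeq)), ?_⟩
          rw [← hμ' t]; rw [mul_comm] at hst; exact hst
        · rintro ⟨htQ₁, ht⟩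
          have htD : t.Coprime D := htQ₁.coprime_dvd_right (dvd_mul_right _ _)
          have htq' : t.Coprime q' := htQ₁.coprime_dvd_right (dvd_mul_left _ _)
          have hts : t * s ≡ μ [MOD d] := (hμ' t).2 ht
          have htd : t.Coprime d := by
            have : (t * s).Coprime d := by rw [Nat.coprime_iff_gcd_eq_one, Nat.ModEq.gcd_eq hts]; exact hμ
            exact Nat.Coprime.coprime_dvd_left (dvd_mul_right _ _) this
          have htQ : t.Coprime Q := by rw [← hQeq]; exact Nat.Coprime.mul_right htq' htd
          refine ⟨htD, Nat.Coprime.mul_left hsQ htQ, ?_⟩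
          rw [mul_comm]; exact hts
      by_cases h1 : t.Coprime D
      · by_cases h2 : ((s * t).Coprime Q ∧ s * t ≡ μ [MOD d])
        · rw [if_pos h1, if_pos h2, if_pos (hiff.1 ⟨h1, h2⟩), mul_one]
        · rw [if_pos h1, if_neg h2, mul_zero, if_neg (fun h => h2 (hiff.2 h).2)]
      · rw [if_neg h1, zero_mul, if_neg (fun h => h1 (hiff.2 h).1)]
    · rw [if_neg hsQ]
      refine Finset.sum_eq_zero fun t _ => ?_
      have hn : ¬ ((s * t).Coprime Q ∧ s * t ≡ μ [MOD d]) :=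
        fun h => hsQ (Nat.Coprime.coprime_dvd_left (dvd_mul_right s t) h.1)
      simp only [hw, if_neg hn, mul_zero]
  choose! μf hμf_cop hμf_eq using hinner
  refine ⟨μf, hμf_cop, ?_⟩
  rw [hsplit]
  refine Finset.sum_congr rfl fun s hs => ?_
  by_cases hsm : s.primeFactors ⊆ D.primeFactors
  · rw [hμf_eq s hs hsm, if_pos hsm]
    unfold smoothCopWeight
    rw [← hD]
    by_cases hsQ : s.Coprime Q
    · rw [if_pos hsQ, if_pos ⟨hsm, hsQ⟩]
    · rw [if_neg hsQ, if_neg (fun h => hsQ h.2), mul_zero, zero_mul]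
  · rw [if_neg hsm, zero_mul, smoothCopWeight_eq_zero hsm, zero_mul]

include hc

/-- **Step 2: one term of the head** (`s ≤ T`, `TE ≤ Y`): the hyperbola estimate for
`goodSum(Y/s)` with `⌊Y/s⌋` replaced by `Y/s` in the main term. [folklore] -/
theorem abs_goodSum_div_sub_le {Q d ν Y E T s : ℕ} (hQ : Squarefree Q) (hdQ : d ∣ Q)
    (hdD : d.Coprime (badMod a b c)) (hν : ν.Coprime d) (hE : 1 ≤ E) (hTEY : T * E ≤ Y)
    (hs : s ∈ Finset.Icc 1 T) {L : ℝ} (hL : Real.log E ≤ L) :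
    |goodSum a b c (Y / s) (badMod a b c * (Q / d)) d ν -
        (Nat.totient (badMod a b c * (Q / d)) : ℝ) / ((badMod a b c * (Q / d) : ℕ) : ℝ) * ((Y : ℝ) / s / d) *
          psiSeries (b ^ 2 - 4 * a * c) (badMod a b c * (Q / d) * d) E| ≤
      ((badMod a b c * (Q / d)).divisors.card + 1) * E +
        2 * (2 * (4 * (b ^ 2 - 4 * a * c).natAbs) * (badMod a b c * (Q / d)).divisors.card) * ((Y : ℝ) / s) / Real.sqrt E +
        (2 + L) := by
  set D := badMod a b c with hD
  set Δ := b ^ 2 - 4 * a * c with hΔ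
  have hD0 : D ≠ 0 := badMod_ne_zero ha hirr
  have hQ0 : Q ≠ 0 := hQ.ne_zero
  have hd0 : 0 < d := Nat.pos_of_dvd_of_pos hdQ (Nat.pos_of_ne_zero hQ0)
  set q' := Q / d with hq'
  have hQeq : q' * d = Q := Nat.div_mul_cancel hdQ
  have hq'0 : q' ≠ 0 := by intro h; rw [h, zero_mul] at hQeq; exact hQ0 hQeq.symm
  have hq'd : q'.Coprime d := by
    have := hQ; rw [← hQeq, Nat.squarefree_mul_iff] at this; exact this.1
  set Q₁ := D * q' with hQ₁
  have hQ₁0 : Q₁ ≠ 0 := mul_ne_zero hD0 hq'0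
  have hQ₁d : Q₁.Coprime d := Nat.Coprime.mul_left hdD.symm hq'd
  have hsub : D.primeFactors ⊆ Q₁.primeFactors := Nat.primeFactors_mono (dvd_mul_right D q') hQ₁0
  -- `(d, 4Δ) = 1`
  have hdN : d.Coprime (4 * Δ.natAbs) := by
    have h2 : d.Coprime 2 := Nat.Coprime.coprime_dvd_right (by
      rw [hD]; unfold badMod; rw [← Int.natCast_dvd]; push_cast
      exact dvd_mul_of_dvd_left (dvd_mul_right 2 a) _) hdD
    have hΔ' : d.Coprime Δ.natAbs := Nat.Coprime.coprime_dvd_right (by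
      rw [hD]; unfold badMod; rw [Int.natAbs_mul]; exact dvd_mul_left _ _) hdD
    rw [show (4 : ℕ) = 2 ^ 2 by norm_num]
    exact Nat.Coprime.mul_right (Nat.Coprime.pow_right 2 h2) hΔ'
  rw [Finset.mem_Icc] at hs
  have hs0 : 0 < s := hs.1
  have hs0' : (0 : ℝ) < s := by exact_mod_cast hs0
  have hEW : E ≤ Y / s := by
    rw [Nat.le_div_iff_mul_le hs0]
    calc E * s ≤ E * T := Nat.mul_le_mul_left E hs.2
      _ = T * E := mul_comm _ _
      _ ≤ Y := hTEY
  have hgood := abs_goodSum_sub_le ha hc hirr (ν := ν) (W := Y / s) (E := E) hQ₁0 hd0 hQ₁d hdN hsub hν hE hEW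
  set φQ₁ : ℝ := (Nat.totient Q₁ : ℝ) / Q₁ with hφQ₁
  set Lam : ℝ := psiSeries Δ (Q₁ * d) E with hLam
  have hφQ₁0 : 0 ≤ φQ₁ := by positivity
  have hφQ₁1 : φQ₁ ≤ 1 := by
    rw [hφQ₁, div_le_one (by exact_mod_cast Nat.pos_of_ne_zero hQ₁0)]
    exact_mod_cast Nat.totient_le Q₁
  have hLam : |Lam| ≤ 1 + L := (abs_psiSeries_le Δ _ E).trans (by linarith)
  -- replace `⌊Y/s⌋` by `Y/s`
  have hfl : |φQ₁ * (((Y / s : ℕ) : ℝ) / d) * Lam - φQ₁ * ((Y : ℝ) / s / d) * Lam| ≤ 1 + L := by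
    rw [← sub_mul, ← mul_sub, ← sub_div, abs_mul, abs_mul, abs_of_nonneg hφQ₁0, abs_div,
      abs_of_pos (by exact_mod_cast hd0 : (0 : ℝ) < d)]
    have h1 : |((Y / s : ℕ) : ℝ) - (Y : ℝ) / s| ≤ 1 := by
      rw [abs_sub_comm, abs_le]
      constructor
      · linarith [Nat.cast_div_le (m := Y) (n := s) (α := ℝ)]
      · have := Nat.lt_div_mul_add (a := Y) hs0
        have h' : (Y : ℝ) < (Y / s : ℕ) * s + s := by exact_mod_cast this
        rw [div_sub' (hc := hs0'.ne'), div_le_one hs0']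
        linarith
    have hd1 : (1 : ℝ) ≤ d := by exact_mod_cast hd0
    have hL0 : 0 ≤ 1 + L := le_trans (abs_nonneg _) hLam
    calc φQ₁ * (|((Y / s : ℕ) : ℝ) - (Y : ℝ) / s| / d) * |Lam| ≤ 1 * (1 / 1) * (1 + L) := by
          gcongr
      _ = 1 + L := by ring
  have hW : ((Y / s : ℕ) : ℝ) ≤ (Y : ℝ) / s := Nat.cast_div_le
  have e1 : goodSum a b c (Y / s) Q₁ d ν - φQ₁ * ((Y : ℝ) / s / d) * Lam =
      (goodSum a b c (Y / s) Q₁ d ν - φQ₁ * (((Y / s : ℕ) : ℝ) / d) * Lam) +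
        (φQ₁ * (((Y / s : ℕ) : ℝ) / d) * Lam - φQ₁ * ((Y : ℝ) / s / d) * Lam) := by ring
  rw [e1]
  refine (abs_add_le _ _).trans ?_
  have hmono : 2 * (2 * (4 * ((b ^ 2 - 4 * a * c).natAbs : ℝ)) * Q₁.divisors.card) * ((Y / s : ℕ) : ℝ) / Real.sqrt E ≤
      2 * (2 * (4 * ((b ^ 2 - 4 * a * c).natAbs : ℝ)) * Q₁.divisors.card) * ((Y : ℝ) / s) / Real.sqrt E := by
    apply div_le_div_of_nonneg_right _ (Real.sqrt_nonneg _)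
    exact mul_le_mul_of_nonneg_left hW (by positivity)
  have hgood' := hgood.trans (add_le_add le_rfl hmono)
  linarith [hgood', hfl]

omit hc in
/-- **Step 3: the main term in the `s`-first form**:
`(κ_G/φ(d)) Y = ∑_{s ≤ T} g(s) (φ(Q₁)/Q₁) (Y/(sd)) Λ(E; Q₁d)`, `Q₁ = D₀(Q/d)`. [folklore] -/
theorem kappaG_div_mul_eq {Q d Y E T : ℕ} (hQ : Squarefree Q) (hdQ : d ∣ Q) (hdD : d.Coprime (badMod a b c)) :
    kappaG a b c Q E T / Nat.totient d * Y =
      ∑ s ∈ Finset.Icc 1 T, smoothCopWeight a b c Q s *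
        ((Nat.totient (badMod a b c * (Q / d)) : ℝ) / ((badMod a b c * (Q / d) : ℕ) : ℝ) * ((Y : ℝ) / s / d) *
          psiSeries (b ^ 2 - 4 * a * c) (badMod a b c * (Q / d) * d) E) := by
  set D := badMod a b c with hD
  have hD0 : D ≠ 0 := badMod_ne_zero ha hirr
  have hQ0 : Q ≠ 0 := hQ.ne_zero
  have hd0 : 0 < d := Nat.pos_of_dvd_of_pos hdQ (Nat.pos_of_ne_zero hQ0)
  set q' := Q / d with hq'
  have hQeq : q' * d = Q := Nat.div_mul_cancel hdQ
  have hq'0 : q' ≠ 0 := by intro h; rw [h, zero_mul] at hQeq; exact hQ0 hQeq.symm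
  have hq'd : q'.Coprime d := by
    have := hQ; rw [← hQeq, Nat.squarefree_mul_iff] at this; exact this.1
  set Q₁ := D * q' with hQ₁
  have hQ₁0 : Q₁ ≠ 0 := mul_ne_zero hD0 hq'0
  have hQ₁d : Q₁.Coprime d := Nat.Coprime.mul_left hdD.symm hq'd
  have hQ₁dDQ : Q₁ * d = D * Q := by rw [hQ₁, mul_assoc, hQeq]
  have hφd0 : (0 : ℝ) < Nat.totient d := by exact_mod_cast Nat.totient_pos.2 hd0
  have htot : (Nat.totient (D * Q) : ℝ) = Nat.totient Q₁ * Nat.totient d := by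
    rw [← hQ₁dDQ, Nat.totient_mul hQ₁d]; push_cast; ring
  have hcast : (Q₁ : ℝ) * d = D * Q := by exact_mod_cast hQ₁dDQ
  unfold kappaG
  rw [← hD, htot, smoothRhoSeries_eq, hQ₁dDQ, Finset.mul_sum, Finset.sum_div, Finset.sum_mul]
  refine Finset.sum_congr rfl fun s hs => ?_
  rw [Finset.mem_Icc] at hs
  have hs0 : (0 : ℝ) < s := by exact_mod_cast hs.1
  have hQ₁0' : (0 : ℝ) < Q₁ := by exact_mod_cast Nat.pos_of_ne_zero hQ₁0
  have hd0' : (0 : ℝ) < d := by exact_mod_cast hd0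
  have hD0' : (0 : ℝ) < D := by exact_mod_cast Nat.pos_of_ne_zero hD0
  have hQ0' : (0 : ℝ) < Q := by exact_mod_cast Nat.pos_of_ne_zero hQ0
  field_simp
  linear_combination (psiSeries (b ^ 2 - 4 * a * c) (D * Q) E * smoothCopWeight a b c Q s * (Y : ℝ)) * hcast

omit ha hc hirr in
/-- **Step 4: one term of the tail** (`T < s ≤ Y`): `g(s) goodSum(Y/s) ≤ (g(s)/T) · 2C_ρ Y` by
Chebyshev for `ρ_G`. [folklore] -/
theorem smoothCopWeight_mul_goodSum_le {Cρ : ℝ} (hCρ0 : 0 < Cρ)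
    (hCρ : ∀ y : ℝ, 2 ≤ y → ∑ m ∈ Finset.Icc 1 ⌊y⌋₊, (rhoG a b c m : ℝ) ≤ Cρ * y)
    {Q Q₁ d ν Y T s : ℕ} (hT : 1 ≤ T) (hs : s ∈ Finset.Ioc T Y) :
    smoothCopWeight a b c Q s * goodSum a b c (Y / s) Q₁ d ν ≤ smoothCopWeight a b c Q s / T * (2 * Cρ * Y) := by
  rw [Finset.mem_Ioc] at hs
  have hs0 : 0 < s := by omega
  have hs0' : (0 : ℝ) < s := by exact_mod_cast hs0
  have hT0 : (0 : ℝ) < T := by exact_mod_cast hT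
  have hW1 : 1 ≤ Y / s := (Nat.le_div_iff_mul_le hs0).2 (by simpa using hs.2)
  have hg0 := smoothCopWeight_nonneg (a := a) (b := b) (c := c) Q s
  have hgs1 : goodSum a b c (Y / s) Q₁ d ν ≤ 2 * Cρ * ((Y : ℝ) / s) := by
    have hsub' : goodSum a b c (Y / s) Q₁ d ν ≤ ∑ t ∈ Finset.Icc 1 (Y / s + 1), (rhoG a b c t : ℝ) := by
      unfold goodSum
      calc ∑ m ∈ (Finset.Ioc 0 (Y / s)).filter (fun m => m.Coprime Q₁ ∧ m ≡ ν [MOD d]), (rhoG a b c m : ℝ)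
          ≤ ∑ m ∈ Finset.Ioc 0 (Y / s), (rhoG a b c m : ℝ) :=
            Finset.sum_le_sum_of_subset_of_nonneg (Finset.filter_subset _ _) fun _ _ _ => Nat.cast_nonneg _
        _ ≤ ∑ t ∈ Finset.Icc 1 (Y / s + 1), (rhoG a b c t : ℝ) := by
            rw [Ioc_zero_eq_Icc_one]
            exact Finset.sum_le_sum_of_subset_of_nonneg (Finset.Icc_subset_Icc le_rfl (Nat.le_succ _))
              fun _ _ _ => Nat.cast_nonneg _
    have hC := hCρ ((Y / s + 1 : ℕ) : ℝ) (by exact_mod_cast Nat.succ_le_succ hW1)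
    rw [Nat.floor_natCast] at hC
    have hW : ((Y / s : ℕ) : ℝ) ≤ (Y : ℝ) / s := Nat.cast_div_le
    have hW1' : (1 : ℝ) ≤ (Y / s : ℕ) := by exact_mod_cast hW1
    calc goodSum a b c (Y / s) Q₁ d ν ≤ Cρ * ((Y / s + 1 : ℕ) : ℝ) := hsub'.trans hC
      _ ≤ Cρ * (2 * ((Y / s : ℕ) : ℝ)) := by
          refine mul_le_mul_of_nonneg_left ?_ hCρ0.le
          push_cast; linarith
      _ ≤ 2 * Cρ * ((Y : ℝ) / s) := by nlinarith
  have hsT : (T : ℝ) < s := by exact_mod_cast hs.1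
  calc smoothCopWeight a b c Q s * goodSum a b c (Y / s) Q₁ d ν
      ≤ smoothCopWeight a b c Q s * (2 * Cρ * ((Y : ℝ) / s)) := mul_le_mul_of_nonneg_left hgs1 hg0
    _ = smoothCopWeight a b c Q s / s * (2 * Cρ * Y) := by field_simp
    _ ≤ smoothCopWeight a b c Q s / T * (2 * Cρ * Y) := by
        refine mul_le_mul_of_nonneg_right ?_ (by positivity)
        exact div_le_div_of_nonneg_left hg0 hT0 hsT.le

set_option maxHeartbeats 800000 in
/-- **The mean value of `ρ_G` with coprimality and congruence conditions** (the arithmetic input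
of Lemma 4 for `𝒜_G` and of the main terms of `W, V, U`).  There is `C = C(G) ≥ 0` such that for
`Q` squarefree, `d ∣ Q` with `(d, 2aΔ) = 1`, `(μ, d) = 1`, and parameters `E, T ≥ 1` with
`T E ≤ Y`:
`|∑_{m ≤ Y, (m,Q)=1, m ≡ μ (d)} ρ_G(m) − (κ_G(Q; E, T)/φ(d)) · Y| ≤ C τ(Q) (log₂ Y + 1)^{ω(D₀)+1} (E + Y/√E + Y/T)`.
Proof: `m = s t` with `s` `D₀`-smooth and `t` prime to `D₀ = |2aΔ|` (`ρ_G` multiplicative); for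
`s ≤ T` the hyperbola method for `t` (`abs_goodSum_sub_le`: `ρ_G = 1 ⋆ μ²ψ_Δ` on such `t`,
residue-class counting for `e ≤ E`, character sums for `e > E`); the `s > T` are a tail
`≪ Y/T` by Chebyshev for `ρ_G` and the finite Euler product over the bad primes.
[cite: IwaniecInventiones1978, §4 proof of Lemma 4]; [cite: LemkeOliverActaArith2012, Lemma 6] -/
theorem abs_rhoSumAPG_sub_le :
    ∃ C : ℝ, 0 ≤ C ∧ ∀ (Q d μ Y E T : ℕ), Squarefree Q → d ∣ Q → d.Coprime (badMod a b c) →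
      μ.Coprime d → 1 ≤ E → 1 ≤ T → T * E ≤ Y →
      |(rhoSumAPG a b c Y Q d μ : ℝ) - kappaG a b c Q E T / Nat.totient d * Y| ≤
        C * Q.divisors.card * ((Nat.log 2 Y : ℝ) + 1) ^ ((badMod a b c).primeFactors.card + 1) *
          (E + Y / Real.sqrt E + Y / T) := by
  classical
  obtain ⟨B, hB1, hB⟩ := exists_rhoG_primePow_le ha hirr
  have hdeg : 0 < (quadPoly a b c).natDegree := by rw [natDegree_quadPoly ha.ne']; norm_num
  obtain ⟨Cρ, hCρ0, hCρ'⟩ := Literature.NumberTheory.Sieve.exists_sum_rootCount_le hirr hdeg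
  have hCρ : ∀ y : ℝ, 2 ≤ y → ∑ m ∈ Finset.Icc 1 ⌊y⌋₊, (rhoG a b c m : ℝ) ≤ Cρ * y := fun y hy => by
    simpa only [rhoG] using hCρ' y hy
  set D := badMod a b c with hD
  set N : ℕ := 4 * (b ^ 2 - 4 * a * c).natAbs with hN
  set nP := D.primeFactors.card with hnP
  have hD0 : D ≠ 0 := badMod_ne_zero ha hirr
  set τD : ℝ := (D.divisors.card : ℝ) with hτD
  -- the constants of the four error terms
  set c₁ : ℝ := (τD + 1) * (B : ℝ) ^ nP with hc₁
  set c₂ : ℝ := 4 * N * τD * (2 * (B : ℝ)) ^ nP with hc₂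
  set c₃ : ℝ := 3 * (B : ℝ) ^ nP with hc₃
  set c₄ : ℝ := 2 * Cρ * (B : ℝ) ^ nP with hc₄
  have hBpos : (0 : ℝ) < B := by exact_mod_cast hB1
  have hc₁0 : 0 ≤ c₁ := by positivity
  have hc₂0 : 0 ≤ c₂ := by positivity
  have hc₃0 : 0 ≤ c₃ := by positivity
  have hc₄0 : 0 ≤ c₄ := by positivity
  refine ⟨c₁ + c₂ + c₃ + c₄, by positivity, ?_⟩
  intro Q d μ Y E T hQ hdQ hdD hμ hE hT hTEY
  have hQ0 : Q ≠ 0 := hQ.ne_zero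
  have hd0 : 0 < d := Nat.pos_of_dvd_of_pos hdQ (Nat.pos_of_ne_zero hQ0)
  set q' := Q / d with hq'
  have hQeq : q' * d = Q := Nat.div_mul_cancel hdQ
  set Q₁ := D * q' with hQ₁
  -- sizes
  have hY1 : 1 ≤ Y := le_trans (Nat.one_le_iff_ne_zero.2 (by positivity)) hTEY
  have hTY : T ≤ Y := le_trans (Nat.le_mul_of_pos_right T hE) hTEY
  have hEY : E ≤ Y := le_trans (Nat.le_mul_of_pos_left E hT) hTEY
  have hE0 : (0 : ℝ) < E := by exact_mod_cast hE
  have hT0 : (0 : ℝ) < T := by exact_mod_cast hT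
  have hY0 : (0 : ℝ) < Y := by exact_mod_cast hY1
  have hE1 : (1 : ℝ) ≤ E := by exact_mod_cast hE
  set L : ℝ := (Nat.log 2 Y : ℝ) + 1 with hL
  have hL1 : 1 ≤ L := by rw [hL]; have : (0 : ℝ) ≤ Nat.log 2 Y := Nat.cast_nonneg _; linarith
  have hlogE : Real.log E ≤ L :=
    le_trans (Real.log_le_log hE0 (by exact_mod_cast hEY)) (log_le_natLog_add_one Y)
  have hτQ1 : (1 : ℝ) ≤ Q.divisors.card := by
    exact_mod_cast Finset.card_pos.2 ⟨1, Nat.one_mem_divisors.2 hQ0⟩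
  have hτQ₁ : (Q₁.divisors.card : ℝ) ≤ τD * Q.divisors.card := by
    have h1 : Q₁.divisors.card ≤ D.divisors.card * q'.divisors.card := by
      rw [hQ₁, Nat.divisors_mul]; exact Finset.card_mul_le
    have h2 : q'.divisors.card ≤ Q.divisors.card :=
      Finset.card_le_card (Nat.divisors_subset_of_dvd hQ0 (Dvd.intro d hQeq))
    calc (Q₁.divisors.card : ℝ) ≤ (D.divisors.card * q'.divisors.card : ℕ) := by exact_mod_cast h1
      _ ≤ (D.divisors.card * Q.divisors.card : ℕ) := by exact_mod_cast Nat.mul_le_mul_left _ h2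
      _ = τD * Q.divisors.card := by rw [hτD]; push_cast; ring
  -- the smooth sums
  have hK : ∀ X, X ≤ Y → ∑ s ∈ Finset.Icc 1 X, smoothCopWeight a b c Q s ≤ (B : ℝ) ^ nP * L ^ nP := by
    intro X hX
    refine (sum_smoothCopWeight_le hB Q X).trans ?_
    rw [← hD, ← hnP, mul_pow]
    refine mul_le_mul_of_nonneg_left ?_ (by positivity)
    apply pow_le_pow_left₀ (by positivity)
    rw [hL]
    have : Nat.log 2 X ≤ Nat.log 2 Y := Nat.log_mono_right hX
    exact_mod_cast Nat.add_le_add_right this 1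
  have hK1 := sum_smoothCopWeight_div_le hB Q T
  rw [← hD, ← hnP] at hK1
  have hg0 : ∀ s, 0 ≤ smoothCopWeight a b c Q s := fun s => smoothCopWeight_nonneg Q s
  -- Step 1
  obtain ⟨μf, hμf, hR⟩ := rhoSumAPG_eq_sum_smoothCopWeight ha hirr (Y := Y) hQ hdQ hdD hμ
  rw [← hD] at hμf hR
  have hIccT : Finset.Icc 1 Y = Finset.Icc 1 T ∪ Finset.Ioc T Y := by
    rw [← Ioc_zero_eq_Icc_one, ← Ioc_zero_eq_Icc_one, Finset.Ioc_union_Ioc_eq_Ioc (Nat.zero_le T) hTY]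
  have hdisjT : Disjoint (Finset.Icc 1 T) (Finset.Ioc T Y) := by
    rw [← Ioc_zero_eq_Icc_one]; exact Finset.Ioc_disjoint_Ioc_of_le le_rfl
  rw [hR, hIccT, Finset.sum_union hdisjT]
  -- abbreviations
  set φQ₁ : ℝ := (Nat.totient (D * (Q / d)) : ℝ) / ((D * (Q / d) : ℕ) : ℝ) with hφQ₁
  set Lam : ℝ := psiSeries (b ^ 2 - 4 * a * c) (D * (Q / d) * d) E with hLam
  set τ₁ : ℝ := ((D * (Q / d)).divisors.card : ℝ) with hτ₁
  set M : ℝ := 2 * (4 * ((b ^ 2 - 4 * a * c).natAbs : ℝ)) * (D * (Q / d)).divisors.card with hM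
  have hM' : M = 2 * N * τ₁ := by rw [hM, hN, hτ₁]; push_cast; ring
  -- Step 2-3: the head
  have hHead : |∑ s ∈ Finset.Icc 1 T, smoothCopWeight a b c Q s * goodSum a b c (Y / s) Q₁ d (μf s) -
      kappaG a b c Q E T / Nat.totient d * Y| ≤
      (τ₁ + 1) * E * ((B : ℝ) ^ nP * L ^ nP) + 2 * M * Y / Real.sqrt E * (2 * (B : ℝ)) ^ nP +
        (2 + L) * ((B : ℝ) ^ nP * L ^ nP) := by
    rw [kappaG_div_mul_eq ha hirr (Y := Y) (E := E) (T := T) hQ hdQ hdD, ← hD, ← Finset.sum_sub_distrib]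
    refine (Finset.abs_sum_le_sum_abs _ _).trans ?_
    have hterm : ∀ s ∈ Finset.Icc 1 T,
        |smoothCopWeight a b c Q s * goodSum a b c (Y / s) Q₁ d (μf s) -
          smoothCopWeight a b c Q s * (φQ₁ * ((Y : ℝ) / s / d) * Lam)| ≤
        smoothCopWeight a b c Q s * ((τ₁ + 1) * E) + smoothCopWeight a b c Q s / s * (2 * M * Y / Real.sqrt E) +
          smoothCopWeight a b c Q s * (2 + L) := by
      intro s hs
      have hsY : s ∈ Finset.Icc 1 Y := by
        rw [Finset.mem_Icc] at hs ⊢; exact ⟨hs.1, hs.2.trans hTY⟩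
      have hs0' : (0 : ℝ) < s := by rw [Finset.mem_Icc] at hs; exact_mod_cast hs.1
      rw [← mul_sub, abs_mul, abs_of_nonneg (hg0 s)]
      by_cases hsm : s.primeFactors ⊆ D.primeFactors
      · have hb := abs_goodSum_div_sub_le ha hc hirr (ν := μf s) (Y := Y) hQ hdQ hdD (hμf s hsY hsm) hE hTEY hs hlogE
        rw [← hD, ← hφQ₁, ← hLam, ← hτ₁, ← hM] at hb
        calc smoothCopWeight a b c Q s * |goodSum a b c (Y / s) Q₁ d (μf s) - φQ₁ * ((Y : ℝ) / s / d) * Lam|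
            ≤ smoothCopWeight a b c Q s * ((τ₁ + 1) * E + 2 * M * ((Y : ℝ) / s) / Real.sqrt E + (2 + L)) :=
              mul_le_mul_of_nonneg_left hb (hg0 s)
          _ = _ := by field_simp
      · rw [smoothCopWeight_eq_zero hsm]; simp
    refine (Finset.sum_le_sum hterm).trans ?_
    rw [Finset.sum_add_distrib, Finset.sum_add_distrib, ← Finset.sum_mul, ← Finset.sum_mul, ← Finset.sum_mul]
    have hτ₁0 : 0 ≤ τ₁ := Nat.cast_nonneg _
    have hM0 : 0 ≤ M := by rw [hM]; positivity
    have h1 : (∑ s ∈ Finset.Icc 1 T, smoothCopWeight a b c Q s) * ((τ₁ + 1) * E) ≤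
        (τ₁ + 1) * E * ((B : ℝ) ^ nP * L ^ nP) := by
      rw [mul_comm]; exact mul_le_mul_of_nonneg_left (hK T hTY) (by positivity)
    have h2 : (∑ s ∈ Finset.Icc 1 T, smoothCopWeight a b c Q s / s) * (2 * M * Y / Real.sqrt E) ≤
        2 * M * Y / Real.sqrt E * (2 * (B : ℝ)) ^ nP := by
      rw [mul_comm]; exact mul_le_mul_of_nonneg_left hK1 (by positivity)
    have h3 : (∑ s ∈ Finset.Icc 1 T, smoothCopWeight a b c Q s) * (2 + L) ≤ (2 + L) * ((B : ℝ) ^ nP * L ^ nP) := by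
      rw [mul_comm]; exact mul_le_mul_of_nonneg_left (hK T hTY) (by linarith)
    linarith
  -- Step 4: the tail
  have hTail : |∑ s ∈ Finset.Ioc T Y, smoothCopWeight a b c Q s * goodSum a b c (Y / s) Q₁ d (μf s)| ≤
      2 * Cρ * Y / T * ((B : ℝ) ^ nP * L ^ nP) := by
    have hnn : 0 ≤ ∑ s ∈ Finset.Ioc T Y, smoothCopWeight a b c Q s * goodSum a b c (Y / s) Q₁ d (μf s) :=
      Finset.sum_nonneg fun s _ => mul_nonneg (hg0 s)
        (by unfold goodSum; exact Finset.sum_nonneg fun _ _ => Nat.cast_nonneg _)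
    rw [abs_of_nonneg hnn]
    refine (Finset.sum_le_sum fun s hs => smoothCopWeight_mul_goodSum_le hCρ0 hCρ hT hs).trans ?_
    rw [← Finset.sum_mul, ← Finset.sum_div]
    have hsub' : ∑ s ∈ Finset.Ioc T Y, smoothCopWeight a b c Q s ≤ (B : ℝ) ^ nP * L ^ nP := by
      refine le_trans ?_ (hK Y le_rfl)
      rw [hIccT]
      exact Finset.sum_le_sum_of_subset_of_nonneg Finset.subset_union_right fun _ _ _ => hg0 _
    calc (∑ s ∈ Finset.Ioc T Y, smoothCopWeight a b c Q s) / T * (2 * Cρ * Y)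
        ≤ ((B : ℝ) ^ nP * L ^ nP) / T * (2 * Cρ * Y) := by
          refine mul_le_mul_of_nonneg_right (div_le_div_of_nonneg_right hsub' hT0.le) (by positivity)
      _ = 2 * Cρ * Y / T * ((B : ℝ) ^ nP * L ^ nP) := by field_simp
  -- Step 5: assembly of the constants
  set X : ℝ := (Q.divisors.card : ℝ) * L ^ (nP + 1) with hX
  have hLnP : L ^ nP ≤ L ^ (nP + 1) := by rw [pow_succ]; exact le_mul_of_one_le_right (by positivity) hL1
  have hKX : (B : ℝ) ^ nP * L ^ nP ≤ (B : ℝ) ^ nP * X := by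
    refine mul_le_mul_of_nonneg_left (hLnP.trans ?_) (by positivity)
    rw [hX]; exact le_mul_of_one_le_left (by positivity) hτQ1
  have hX0 : 0 ≤ X := by positivity
  have hYE : 0 ≤ (Y : ℝ) / Real.sqrt E := by positivity
  have hYT : 0 ≤ (Y : ℝ) / T := by positivity
  have t1 : (τ₁ + 1) * E * ((B : ℝ) ^ nP * L ^ nP) ≤ c₁ * (X * E) := by
    have h1 : τ₁ + 1 ≤ (τD + 1) * Q.divisors.card := by
      have e : (τD + 1) * (Q.divisors.card : ℝ) = τD * Q.divisors.card + Q.divisors.card := by ring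
      rw [e]; linarith [hτQ₁, hτQ1]
    calc (τ₁ + 1) * E * ((B : ℝ) ^ nP * L ^ nP) ≤ ((τD + 1) * Q.divisors.card) * E * ((B : ℝ) ^ nP * L ^ (nP + 1)) := by
          gcongr
      _ = c₁ * (X * E) := by rw [hc₁, hX]; ring
  have t2 : 2 * M * Y / Real.sqrt E * (2 * (B : ℝ)) ^ nP ≤ c₂ * (X * (Y / Real.sqrt E)) := by
    rw [hM']
    have h1 : τ₁ ≤ τD * X := by
      calc τ₁ ≤ τD * Q.divisors.card := hτQ₁
        _ ≤ τD * X := by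
            rw [hX]
            exact mul_le_mul_of_nonneg_left (le_mul_of_one_le_right (by positivity) (one_le_pow₀ hL1)) (by positivity)
    have hN0 : (0 : ℝ) ≤ N := Nat.cast_nonneg _
    calc 2 * (2 * (N : ℝ) * τ₁) * Y / Real.sqrt E * (2 * (B : ℝ)) ^ nP
        = (4 * N * (2 * (B : ℝ)) ^ nP * (Y / Real.sqrt E)) * τ₁ := by ring
      _ ≤ (4 * N * (2 * (B : ℝ)) ^ nP * (Y / Real.sqrt E)) * (τD * X) :=
          mul_le_mul_of_nonneg_left h1 (by positivity)
      _ = c₂ * (X * (Y / Real.sqrt E)) := by rw [hc₂]; ring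
  have t3 : (2 + L) * ((B : ℝ) ^ nP * L ^ nP) ≤ c₃ * (X * E) := by
    have h1 : (2 + L) * L ^ nP ≤ 3 * L ^ (nP + 1) := by
      have h0 : 0 ≤ L ^ nP := pow_nonneg (by linarith) nP
      have hprod : 0 ≤ L ^ nP * (L - 1) := mul_nonneg h0 (sub_nonneg.2 hL1)
      rw [pow_succ]; nlinarith [hprod]
    calc (2 + L) * ((B : ℝ) ^ nP * L ^ nP) = (B : ℝ) ^ nP * ((2 + L) * L ^ nP) := by ring
      _ ≤ (B : ℝ) ^ nP * (3 * L ^ (nP + 1)) := mul_le_mul_of_nonneg_left h1 (by positivity)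
      _ = c₃ * (1 * L ^ (nP + 1) * 1) := by rw [hc₃]; ring
      _ ≤ c₃ * (X * E) := by
          refine mul_le_mul_of_nonneg_left ?_ hc₃0
          rw [hX]; gcongr
  have t4 : 2 * Cρ * Y / T * ((B : ℝ) ^ nP * L ^ nP) ≤ c₄ * (X * (Y / T)) := by
    calc 2 * Cρ * Y / T * ((B : ℝ) ^ nP * L ^ nP) = 2 * Cρ * ((B : ℝ) ^ nP * L ^ nP) * (Y / T) := by ring
      _ ≤ 2 * Cρ * ((B : ℝ) ^ nP * X) * (Y / T) := by gcongr
      _ = c₄ * (X * (Y / T)) := by rw [hc₄]; ring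
  have hsum : |(∑ s ∈ Finset.Icc 1 T, smoothCopWeight a b c Q s * goodSum a b c (Y / s) Q₁ d (μf s) +
        ∑ s ∈ Finset.Ioc T Y, smoothCopWeight a b c Q s * goodSum a b c (Y / s) Q₁ d (μf s)) -
      kappaG a b c Q E T / Nat.totient d * Y| ≤
      c₁ * (X * E) + c₂ * (X * (Y / Real.sqrt E)) + c₃ * (X * E) + c₄ * (X * (Y / T)) := by
    have := abs_add_le (∑ s ∈ Finset.Icc 1 T, smoothCopWeight a b c Q s * goodSum a b c (Y / s) Q₁ d (μf s) -
        kappaG a b c Q E T / Nat.totient d * Y)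
      (∑ s ∈ Finset.Ioc T Y, smoothCopWeight a b c Q s * goodSum a b c (Y / s) Q₁ d (μf s))
    rw [show ∀ x y z : ℝ, x - z + y = x + y - z from fun x y z => by ring] at this
    linarith [hHead, hTail]
  refine hsum.trans ?_
  have e : (c₁ + c₂ + c₃ + c₄) * Q.divisors.card * L ^ (nP + 1) * (E + Y / Real.sqrt E + Y / T) =
      (c₁ + c₂ + c₃ + c₄) * (X * E) + (c₁ + c₂ + c₃ + c₄) * (X * (Y / Real.sqrt E)) +
        (c₁ + c₂ + c₃ + c₄) * (X * (Y / T)) := by rw [hX]; ring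
  rw [e]
  have hXE : 0 ≤ X * E := by positivity
  have hXYE : 0 ≤ X * (Y / Real.sqrt E) := by positivity
  have hXYT : 0 ≤ X * (Y / T) := by positivity
  nlinarith [mul_nonneg hc₂0 hXE, mul_nonneg hc₄0 hXE, mul_nonneg hc₁0 hXYE, mul_nonneg hc₃0 hXYE,
    mul_nonneg hc₄0 hXYE, mul_nonneg hc₁0 hXYT, mul_nonneg hc₂0 hXYT, mul_nonneg hc₃0 hXYT]

end MeanValue

end Literature.NumberTheory.Sieve.Iwaniec1978

end
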